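import Literature.Probability.RandomPlanarGeometry.ConformalRectangleProofs
import Literature.Probability.RandomPlanarGeometry.RectangleModulusProofs
import Literature.Probability.RandomPlanarGeometry.ChordalBoundary
import Literature.Probability.RandomPlanarGeometry.HalfPlaneAutomorphism
import Literature.Probability.Percolation.SmirnovConformalProofs
import Literature.Probability.Percolation.QuadCrossingSquareModel
import Literature.Probability.RandomPlanarGeometry.MarkedDomainCorners
import Literature.Analysis.Complex.InjectiveHolomorphic
import Literature.Analysis.Complex.ExtremalLength
import Literature.Topology.PlaneTopology.Schoenflies
import HarnessLib

/-!
# Square tilings of lattice domains: uniformization of a conformal rectangle by a true rectangle,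
# and the cross

Topic: Probability / LatticeModels (continuum input for the proof of [GP19] Corollary 4.15, the
lower half `lim inf_n R^eff_n ≥ d_Ω(T, B)`). For a conformal rectangle `Ω` (a Jordan domain with
four marked boundary points, arcs `0, 1, 2, 3`):

* §U1–§U5 **Theorem U** (`exists_rect_uniformizer`): there are `a, b > 0` and a homeomorphism
  `Ψ` of the closed rectangle `[0,a] × [0,b]` onto `closure Ω`, conformal on the open rectangle
  onto `Ω`, with `Ψ' ≠ 0`, taking the closed vertical sides into the arcs `0` and `2` (in one of
  the two orders), the open vertical sides into the corresponding open arcs and the open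
  horizontal sides into the open arcs `1` (bottom) and `3` (top) — from the Schwarz–Christoffel
  rectangle of `Percolation.QuadCrossingSquareModel` (`exists_isUniformizing_holds`), a real
  Möbius map matching the cross-ratio of the prevertices (`exists_moebius_of_crossRatio_eq`),
  Carathéodory extension (`JordanDomain.exists_extension_of_conformalEquiv`) and the
  identification of the corners (`tendsto_scrFun_scrPrevertex`, `eq_or_eq_of_pt_mem_closure`);
* §U6 `extremalDistance_arc_le`: `d_Ω(arc 0, arc 2) ≤ a / b` (conformal invariance and the
  modulus of a rectangle, `ExtremalLength`);
* §X1–§X5 **the cross** (`exists_cross_data`): two curves `Γ_V`, `Γ_H` in `Ω` joining the open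
  arcs `1 → 3` and `jL → jR` (`{jL, jR} = {0, 2}`), images of the two axes of the rectangle
  twisted near the centre (`twist`) so that they are straight segments of a small disc in `Ω`
  near their unique crossing point, with entrance/exit points on the circle near the four
  cardinal points (`exists_first_entrance`, `exists_entrance_exit`);
* §X6 `cross_separation`: the resulting straightened pieces are pairwise disjoint as needed by
  `SquareTiling.exists_exits_flux_eq` (planar geometry: strict convexity of discs along segments,
  coordinate envelopes);
* §X7 `exists_exterior_curves`: exterior closing curves from two boundary points (radii and an
  arc of the circle of radius `2` under the Schoenflies homeomorphism extending a Carathéodory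
  chart, `JordanDomain.DiscChart.exists_homeomorph_eqOn`).

Everything here is proved; no named fact is introduced.

## References

* [GeorgakopoulosPanagiotis2019] A. Georgakopoulos, C. Panagiotis, *Convergence of square tilings
  to the Riemann map*, arXiv:1910.06886 (2019), §3–§4 (the conformal rectangle and its tiling).
* [AhlforsCA1979] L. V. Ahlfors, *Complex Analysis*, 3rd ed., McGraw–Hill 1979, Ch. 3 §3.1
  (cross-ratio and Möbius maps), Ch. 6 §2.2 (Schwarz–Christoffel for the rectangle).
* [PommerenkeBBCM1992] Ch. Pommerenke, *Boundary Behaviour of Conformal Maps*, Springer 1992,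
  §2.3 Cor. 2.8 (the Schoenflies extension of a Carathéodory chart).
-/

noncomputable section

namespace Literature.Probability.LatticeModels

open _root_.Filter _root_.Set _root_.Metric _root_.Complex
open scoped _root_.Topology
open Literature.Probability.RandomPlanarGeometry

namespace SquareTiling

/-! ### §U1. A real Möbius map through two quadruples with the same cross-ratio -/

section Moebius4

/-- The identity `(a-b)(c-d) - (a-c)(b-d) = -(a-d)(b-c)`. [folklore] -/
theorem sub_mul_sub_sub (a b c d : ℝ) : (a - b) * (c - d) - (a - c) * (b - d) = -((a - d) * (b - c)) := by ring

/-- **Three points and the cross-ratio determine a real Möbius map.** For strictly increasing real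
quadruples `p`, `q` with the same Cardy cross-ratio there are real `a, b, c, d` with `ad - bc > 0`
such that `z ↦ (az + b)/(cz + d)` is finite at every `p i` and maps `p i ↦ q i` (`i < 4`).
[cite: AhlforsCA1979, Ch. 3 §3.1] -/
theorem exists_moebius_of_crossRatio_eq {p q : Fin 4 → ℝ} (hp : StrictMono p) (hq : StrictMono q)
    (hcr : crossRatio p = crossRatio q) :
    ∃ a b c d : ℝ, 0 < a * d - b * c ∧ ∀ i : Fin 4, c * p i + d ≠ 0 ∧ (a * p i + b) / (c * p i + d) = q i := by
  have p01 : p 0 < p 1 := hp (by decide)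
  have p12 : p 1 < p 2 := hp (by decide)
  have p23 : p 2 < p 3 := hp (by decide)
  have q01 : q 0 < q 1 := hq (by decide)
  have q12 : q 1 < q 2 := hq (by decide)
  have q23 : q 2 < q 3 := hq (by decide)
  -- `T_p z = (αp z + βp)/(γp z + δp)` sends `p₀, p₁, p₂ ↦ 0, 1, ∞`; `A = T_q⁻¹ ∘ T_p`
  set αp := p 1 - p 2
  set βp := -(p 0 * (p 1 - p 2))
  set γp := p 1 - p 0
  set δp := -(p 2 * (p 1 - p 0))
  set αq := q 1 - q 2
  set βq := -(q 0 * (q 1 - q 2))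
  set γq := q 1 - q 0
  set δq := -(q 2 * (q 1 - q 0))
  -- `A = adj(T_q) · T_p`
  refine ⟨δq * αp + (-βq) * γp, δq * βp + (-βq) * δp, (-γq) * αp + αq * γp, (-γq) * βp + αq * δp, ?_, ?_⟩
  · have hdet : (δq * αp + (-βq) * γp) * ((-γq) * βp + αq * δp) - (δq * βp + (-βq) * δp) * ((-γq) * αp + αq * γp) =
        (αq * δq - βq * γq) * (αp * δp - βp * γp) := by ring
    rw [hdet]
    have h1 : 0 < αq * δq - βq * γq := by
      have : αq * δq - βq * γq = (q 1 - q 2) * (q 1 - q 0) * (q 0 - q 2) := by ring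
      rw [this]
      have a1 : q 1 - q 2 < 0 := by linarith
      have a2 : 0 < q 1 - q 0 := by linarith
      have a3 : q 0 - q 2 < 0 := by linarith
      nlinarith [mul_pos_of_neg_of_neg a1 a3]
    have h2 : 0 < αp * δp - βp * γp := by
      have : αp * δp - βp * γp = (p 1 - p 2) * (p 1 - p 0) * (p 0 - p 2) := by ring
      rw [this]
      have a1 : p 1 - p 2 < 0 := by linarith
      have a2 : 0 < p 1 - p 0 := by linarith
      have a3 : p 0 - p 2 < 0 := by linarith
      nlinarith [mul_pos_of_neg_of_neg a1 a3]
    exact mul_pos h1 h2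
  · intro i
    -- the cross-ratio identity in polynomial form
    have hcr' : (p 0 - p 1) * (p 2 - p 3) * ((q 0 - q 2) * (q 1 - q 3)) =
        (q 0 - q 1) * (q 2 - q 3) * ((p 0 - p 2) * (p 1 - p 3)) := by
      have hpd : (p 0 - p 2) * (p 1 - p 3) ≠ 0 := mul_ne_zero (by linarith) (by linarith)
      have hqd : (q 0 - q 2) * (q 1 - q 3) ≠ 0 := mul_ne_zero (by linarith) (by linarith)
      unfold crossRatio at hcr
      rw [div_eq_div_iff hpd hqd] at hcr
      linarith
    have hcr'' : (p 0 - p 1) * (p 2 - p 3) * ((q 0 - q 3) * (q 1 - q 2)) =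
        (q 0 - q 1) * (q 2 - q 3) * ((p 0 - p 3) * (p 1 - p 2)) := by linear_combination hcr'
    have hdetne : (δq * αp + (-βq) * γp) * ((-γq) * βp + αq * δp) - (δq * βp + (-βq) * δp) * ((-γq) * αp + αq * γp) ≠ 0 := by
      have hdet : (δq * αp + (-βq) * γp) * ((-γq) * βp + αq * δp) - (δq * βp + (-βq) * δp) * ((-γq) * αp + αq * γp) =
          ((q 1 - q 2) * (q 1 - q 0) * (q 0 - q 2)) * ((p 1 - p 2) * (p 1 - p 0) * (p 0 - p 2)) := by ring
      rw [hdet]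
      exact mul_ne_zero (mul_ne_zero (mul_ne_zero (by linarith) (by linarith)) (by linarith))
        (mul_ne_zero (mul_ne_zero (by linarith) (by linarith)) (by linarith))
    -- a common argument: if the value is right whenever the denominator is nonzero, and the
    -- determinant is nonzero, then the denominator is nonzero
    have key : ∀ (z w : ℝ), (δq * αp + (-βq) * γp) * z + (δq * βp + (-βq) * δp) = w * (((-γq) * αp + αq * γp) * z + ((-γq) * βp + αq * δp)) →
        ((-γq) * αp + αq * γp) * z + ((-γq) * βp + αq * δp) ≠ 0 ∧
          ((δq * αp + (-βq) * γp) * z + (δq * βp + (-βq) * δp)) / (((-γq) * αp + αq * γp) * z + ((-γq) * βp + αq * δp)) = w := by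
      intro z w h
      have hne : ((-γq) * αp + αq * γp) * z + ((-γq) * βp + αq * δp) ≠ 0 := by
        intro h0
        rw [h0, mul_zero] at h
        -- `M (z, 1)ᵀ = 0` forces `det M = 0`
        apply hdetne
        have e1 : ((δq * αp + (-βq) * γp) * ((-γq) * βp + αq * δp) - (δq * βp + (-βq) * δp) * ((-γq) * αp + αq * γp)) * z = 0 := by
          linear_combination ((-γq) * βp + αq * δp) * h - (δq * βp + (-βq) * δp) * h0
        rcases mul_eq_zero.1 e1 with h1 | h1
        · exact h1
        · rw [h1, mul_zero, zero_add] at h h0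
          rw [h, h0]; ring
      exact ⟨hne, by rw [div_eq_iff hne, h]⟩
    fin_cases i
    · exact key (p 0) (q 0) (by ring)
    · exact key (p 1) (q 1) (by ring)
    · exact key (p 2) (q 2) (by ring)
    · exact key (p 3) (q 3) (by linear_combination hcr'')

end Moebius4

/-! ### §U2. A conformal equivalence of the Schwarz–Christoffel rectangle onto `Ω` with the
corners corresponding -/

section SCRect

open UpperHalfPlane (upperHalfPlaneSet)

variable {k : ℝ}

/-- The Schwarz–Christoffel rectangle `(-K, K) × (0, K')` as a conformal rectangle (corners marked
counterclockwise from the bottom-left one). [folklore] -/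
def scrQuad (k : ℝ) (hk0 : 0 < k) (hk1 : k < 1) : ConformalRectangle :=
  Percolation.rectQuad (-ellipticK (k ^ 2)) (ellipticK (k ^ 2)) 0 (ellipticK (1 - k ^ 2))
    (by linarith [ellipticK_sq_pos hk0 hk1]) (ellipticK_one_sub_sq_pos hk0 hk1)

/-- The carrier of `scrQuad` is `scrRect`. [folklore] -/
theorem scrQuad_carrier (hk0 : 0 < k) (hk1 : k < 1) : (scrQuad k hk0 hk1).carrier = scrRect k := by
  rw [scrQuad, Percolation.rectQuad_carrier]; rfl

/-- The Schwarz–Christoffel map as a conformal equivalence `ℍₒ → scrRect k`. [folklore] -/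
theorem exists_scrEquiv (hk0 : 0 < k) (hk1 : k < 1) :
    ∃ Φ : ConformalEquiv upperHalfPlaneSet (scrQuad k hk0 hk1).carrier, ∀ z, Φ z = scrFun k z := by
  have hbij : BijOn (scrFun k) upperHalfPlaneSet (scrQuad k hk0 hk1).carrier := by
    rw [scrQuad_carrier]; exact scrFun_bijOn hk0 hk1
  have hdiff : DifferentiableOn ℂ (scrFun k) upperHalfPlaneSet :=
    differentiableOn_scrFun_upperHalfPlaneSet hk0.le hk1.le
  have hderiv : ∀ z ∈ upperHalfPlaneSet, deriv (scrFun k) z ≠ 0 := by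
    intro z hz
    rw [(hasDerivAt_scrFun_of_mem hk0.le hk1.le hz).deriv]
    exact scrDeriv_ne_zero hk0.le hk1.le (upperHalfPlaneSet_subset_scrDomain hz)
  have hinv : DifferentiableOn ℂ (Function.invFunOn (scrFun k) upperHalfPlaneSet) (scrQuad k hk0 hk1).carrier := by
    rw [← hbij.image_eq]
    exact Complex.differentiableOn_invFunOn_image UpperHalfPlane.isOpen_upperHalfPlaneSet hdiff hbij.injOn hderiv
  exact ⟨ConformalEquiv.ofBijOn (scrFun k) hdiff hbij hinv, fun z => rfl⟩

/-- The corners of the Schwarz–Christoffel rectangle, in the order of the prevertices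
`-1/k, -1, 1, 1/k`: `-K + iK'`, `-K`, `K`, `K + iK'`. [folklore] -/
def scrCorner (k : ℝ) : Fin 4 → ℂ :=
  ![-(ellipticK (k ^ 2) : ℂ) + I * (ellipticK (1 - k ^ 2) : ℂ), -(ellipticK (k ^ 2) : ℂ), (ellipticK (k ^ 2) : ℂ),
    (ellipticK (k ^ 2) : ℂ) + I * (ellipticK (1 - k ^ 2) : ℂ)]

/-- Boundary values of the Schwarz–Christoffel map at the prevertices. [cite: BollobasRiordan2006, Ch. 7 §7.1 p. 185] -/
theorem tendsto_scrFun_scrPrevertex (hk0 : 0 < k) (hk1 : k < 1) (i : Fin 4) :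
    Tendsto (scrFun k) (𝓝[upperHalfPlaneSet] ((scrPrevertex k i : ℝ) : ℂ)) (𝓝 (scrCorner k i)) := by
  fin_cases i
  · simpa [scrPrevertex, scrCorner] using tendsto_scrFun_neg_inv hk0 hk1
  · have := tendsto_scrFun_neg_one hk0 hk1
    simpa [scrPrevertex, scrCorner] using this
  · have := tendsto_scrFun_one hk0 hk1
    simpa [scrPrevertex, scrCorner] using this
  · simpa [scrPrevertex, scrCorner] using tendsto_scrFun_inv hk0 hk1

/-- **The Schwarz–Christoffel rectangle is conformally equivalent to any conformal rectangle with
the same modulus, corners corresponding** (Ahlfors (1979), Ch. 6 §1.1 and §2.2: Riemann map,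
a real Möbius map matching the prevertices, and the Schwarz–Christoffel map). For every conformal
rectangle `R` there are `0 < k < 1`, a conformal equivalence `G` of `scrRect k` onto `Ω` and a
bijection `τ` of the indices, `τ = id` or `τ = rev`, with `G → R.pt (τ i)` at the corner
`scrCorner k i`. [cite: AhlforsCA1979, Ch. 6 §1.1 Thm. 1] -/
theorem exists_conformalEquiv_scrRect (R : ConformalRectangle) :
    ∃ (k : ℝ) (hk0 : 0 < k) (hk1 : k < 1) (G : ConformalEquiv (scrQuad k hk0 hk1).carrier R.carrier) (τ : Fin 4 ≃ Fin 4),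
      (τ = Equiv.refl _ ∨ τ = Fin.revPerm) ∧ ∀ i, G.HasBoundaryValue (scrCorner k i) (R.pt (τ i)) := by
  classical
  -- a uniformizing datum of `R`, made increasing
  obtain ⟨φ, x, hφx⟩ := MarkedDomain.exists_isUniformizing_holds R
  obtain ⟨y, τ, hτ, hy, hbv⟩ : ∃ (y : Fin 4 → ℝ) (τ : Fin 4 ≃ Fin 4), (τ = Equiv.refl _ ∨ τ = Fin.revPerm) ∧
      StrictMono y ∧ ∀ i, φ.HasBoundaryValue (y i) (R.pt (τ i)) := by
    rcases hφx.1 with hm | ha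
    · exact ⟨x, Equiv.refl _, Or.inl rfl, hm, fun i => hφx.2 i⟩
    · refine ⟨x ∘ Fin.rev, Fin.revPerm, Or.inr rfl, fun i j hij => ha (by simpa using hij), fun i => ?_⟩
      simpa using hφx.2 (Fin.rev i)
  -- the modulus
  have hcr : crossRatio y ∈ Ioo (0 : ℝ) 1 := crossRatio_mem_Ioo (Or.inl hy)
  set c := crossRatio y with hc
  set k : ℝ := (1 - Real.sqrt c) / (1 + Real.sqrt c) with hk
  have hsc : 0 < Real.sqrt c := Real.sqrt_pos.2 hcr.1
  have hsc1 : Real.sqrt c < 1 := by rw [Real.sqrt_lt' one_pos]; simpa using hcr.2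
  have hk0 : 0 < k := by rw [hk]; exact div_pos (by linarith) (by linarith)
  have hk1 : k < 1 := by rw [hk, div_lt_one (by linarith)]; linarith
  have hcrk : crossRatio (scrPrevertex k) = crossRatio y := by
    rw [crossRatio_scrPrevertex hk0 hk1, ← hc]
    have h1 : (1 - k) / (1 + k) = Real.sqrt c := by
      rw [hk]; field_simp; ring
    rw [← div_pow, h1, Real.sq_sqrt hcr.1.le]
  -- the Möbius map
  obtain ⟨a, b, c', d, hdet, hA⟩ := exists_moebius_of_crossRatio_eq (strictMono_scrPrevertex hk0 hk1) hy hcrk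
  set ψ₁ : ConformalEquiv upperHalfPlaneSet R.carrier := (ConformalEquiv.realMobius a b c' d hdet).trans φ with hψ₁
  have hψ₁ : ∀ i, ψ₁.HasBoundaryValue (scrPrevertex k i) (R.pt (τ i)) := fun i =>
    ConformalEquiv.hasBoundaryValue_realMobius_trans hdet φ (hA i).1 (by rw [(hA i).2]; exact hbv i)
  -- the Schwarz–Christoffel equivalence and its inverse boundary behaviour
  obtain ⟨Φ, hΦ⟩ := exists_scrEquiv hk0 hk1
  obtain ⟨Ψc, hΨc, hΨeq, hbij, -⟩ := JordanDomain.exists_continuousOn_extension_holds (scrQuad k hk0 hk1).toJordanDomain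
    (cayley.symm.trans Φ)
  have hΦbv : ∀ i, Φ.HasBoundaryValue (scrPrevertex k i) (scrCorner k i) := fun i => by
    have := tendsto_scrFun_scrPrevertex hk0 hk1 i
    exact this.congr fun z => (hΦ z).symm
  have hsymm : ∀ i, Tendsto Φ.symm (𝓝[(scrQuad k hk0 hk1).carrier] (scrCorner k i))
      (𝓝[upperHalfPlaneSet] ((scrPrevertex k i : ℝ) : ℂ)) := fun i =>
    tendsto_nhdsWithin_iff.2 ⟨JordanDomain.tendsto_symm_nhds Φ hΨc hΨeq hbij.injOn (hΦbv i),
      eventually_nhdsWithin_of_forall fun z hz => Φ.symm_mapsTo hz⟩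
  refine ⟨k, hk0, hk1, Φ.symm.trans ψ₁, τ, hτ, fun i => ?_⟩
  exact (hψ₁ i).comp (hsymm i)

end SCRect

/-! ### §U3. The continuous extension and the corners -/

section Extension

open UpperHalfPlane (upperHalfPlaneSet)

variable {k : ℝ}

/-- The corners of the Schwarz–Christoffel rectangle lie in its closure. [folklore] -/
theorem scrCorner_mem_closure (hk0 : 0 < k) (hk1 : k < 1) (i : Fin 4) :
    scrCorner k i ∈ closure (scrQuad k hk0 hk1).carrier := by
  have hK := ellipticK_sq_pos hk0 hk1
  have hK' := ellipticK_one_sub_sq_pos hk0 hk1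
  rw [scrQuad_carrier, scrRect, closure_reProdIm, closure_Ioo (by linarith), closure_Ioo hK'.ne, mem_reProdIm]
  fin_cases i <;> simp [scrCorner, hK.le, hK'.le]

/-- **The uniformizing homeomorphism of the closed Schwarz–Christoffel rectangle onto `closure Ω`**
(Carathéodory): the conformal equivalence of `exists_conformalEquiv_scrRect` extends to a
continuous bijection `closure (scrRect k) → closure Ω` mapping the frontier into the frontier and
the corner `scrCorner k i` to `R.pt (τ i)`. [cite: PommerenkeBBCM1992, Thm. 2.6] -/
theorem exists_uniformizer (R : ConformalRectangle) :
    ∃ (k : ℝ) (hk0 : 0 < k) (hk1 : k < 1) (G : ConformalEquiv (scrQuad k hk0 hk1).carrier R.carrier)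
      (Ψ : ℂ → ℂ) (τ : Fin 4 ≃ Fin 4), (τ = Equiv.refl _ ∨ τ = Fin.revPerm) ∧
      ContinuousOn Ψ (closure (scrRect k)) ∧ EqOn Ψ G (scrRect k) ∧
      BijOn Ψ (closure (scrRect k)) (closure R.carrier) ∧ MapsTo Ψ (frontier (scrRect k)) (frontier R.carrier) ∧
      ∀ i, Ψ (scrCorner k i) = R.pt (τ i) := by
  obtain ⟨k, hk0, hk1, G, τ, hτ, hbv⟩ := exists_conformalEquiv_scrRect R
  obtain ⟨Ψ, hΨc, hΨeq, hΨbij, hΨfr⟩ := JordanDomain.exists_extension_of_conformalEquiv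
    JordanDomain.exists_continuousOn_extension_holds (scrQuad k hk0 hk1).toJordanDomain R.toJordanDomain G
  have hcar := scrQuad_carrier hk0 hk1
  refine ⟨k, hk0, hk1, G, Ψ, τ, hτ, by rwa [← hcar], by rw [← hcar]; exact hΨeq, by rwa [← hcar], by rw [← hcar]; exact hΨfr,
    fun i => ?_⟩
  -- the value at a corner is the boundary value
  have hmem := scrCorner_mem_closure hk0 hk1 i
  haveI : (𝓝[(scrQuad k hk0 hk1).carrier] (scrCorner k i)).NeBot := mem_closure_iff_nhdsWithin_neBot.1 hmem
  have h1 : Tendsto Ψ (𝓝[(scrQuad k hk0 hk1).carrier] (scrCorner k i)) (𝓝 (Ψ (scrCorner k i))) :=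
    ((hΨc _ hmem).mono_left (nhdsWithin_mono _ subset_closure))
  have h2 : Tendsto Ψ (𝓝[(scrQuad k hk0 hk1).carrier] (scrCorner k i)) (𝓝 (R.pt (τ i))) :=
    (hbv i).congr' (eventually_nhdsWithin_of_forall fun z hz => (hΨeq hz).symm)
  exact tendsto_nhds_unique h1 h2

end Extension

/-! ### §U4. Sides go to arcs -/

section Sides

open UpperHalfPlane (upperHalfPlaneSet)

variable {k : ℝ}

/-- The open part of arc `i`: the boundary points with parameter strictly between the marks.
[folklore] -/
def openArc (R : ConformalRectangle) (i : Fin 4) : Set ℂ :=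
  R.boundary '' Ioo (R.mark i) (R.nextMark i)

/-- The open arc lies in the closed arc. [folklore] -/
theorem openArc_subset_arc (R : ConformalRectangle) (i : Fin 4) : openArc R i ⊆ R.arc i :=
  image_mono Ioo_subset_Icc_self

/-- A frontier point which is not a corner lies in some open arc. [folklore] -/
theorem exists_mem_openArc (R : ConformalRectangle) {z : ℂ} (hz : z ∈ frontier R.carrier)
    (hpt : ∀ m, z ≠ R.pt m) : ∃ i, z ∈ openArc R i := by
  have hU := R.iUnion_arc_holds
  rw [← hU, mem_iUnion] at hz
  obtain ⟨i, t, ht, rfl⟩ := hz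
  rcases ht.1.eq_or_lt with h1 | h1
  · exact (hpt i (by rw [← h1]; rfl)).elim
  rcases ht.2.lt_or_eq with h2 | h2
  · exact ⟨i, t, ⟨h1, h2⟩, rfl⟩
  · exact (hpt (i + 1) (by rw [h2, R.boundary_nextMark])).elim

/-- Open arcs miss the other closed arcs. [folklore] -/
theorem openArc_disjoint_arc (R : ConformalRectangle) {i j : Fin 4} (hij : j ≠ i) : Disjoint (openArc R i) (R.arc j) := by
  rw [Set.disjoint_left]
  rintro _ ⟨t, ht, rfl⟩
  exact R.boundary_not_mem_arc hij ht

/-- **A connected subset of the boundary off the corners lies in a single open arc.**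
[folklore] -/
theorem exists_subset_openArc (R : ConformalRectangle) {s : Set ℂ} (hs : IsPreconnected s)
    (hsf : s ⊆ frontier R.carrier) (hpt : ∀ z ∈ s, ∀ m, z ≠ R.pt m) (hne : s.Nonempty) :
    ∃ i, s ⊆ openArc R i := by
  obtain ⟨z₀, hz₀⟩ := hne
  obtain ⟨i, hi⟩ := exists_mem_openArc R (hsf hz₀) (hpt z₀ hz₀)
  refine ⟨i, ?_⟩
  -- `u` = complement of the other arcs, `v` = complement of arc `i`
  set u : Set ℂ := (⋃ j ∈ ({j | j ≠ i} : Set (Fin 4)), R.arc j)ᶜ with hu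
  set v : Set ℂ := (R.arc i)ᶜ with hv
  have huo : IsOpen u := by
    rw [hu, isOpen_compl_iff]
    exact (Set.toFinite _).isClosed_biUnion fun j _ => R.isClosed_arc j
  have hvo : IsOpen v := (R.isClosed_arc i).isOpen_compl
  have hsuv : s ⊆ u ∪ v := by
    intro z hz
    obtain ⟨j, hj⟩ := exists_mem_openArc R (hsf hz) (hpt z hz)
    by_cases hji : j = i
    · subst hji
      left
      rw [hu, mem_compl_iff, mem_iUnion₂]
      rintro ⟨j', hj', hzj'⟩
      exact Set.disjoint_left.1 (openArc_disjoint_arc R hj') hj hzj'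
    · right
      exact fun hzi => Set.disjoint_left.1 (openArc_disjoint_arc R (Ne.symm hji)) hj hzi
  have hdisj : s ∩ (u ∩ v) = ∅ := by
    rw [Set.eq_empty_iff_forall_notMem]
    rintro z ⟨hz, hzu, hzv⟩
    obtain ⟨j, hj⟩ := exists_mem_openArc R (hsf hz) (hpt z hz)
    by_cases hji : j = i
    · subst hji; exact hzv (openArc_subset_arc R j hj)
    · rw [hu, mem_compl_iff, mem_iUnion₂] at hzu
      exact hzu ⟨j, hji, openArc_subset_arc R j hj⟩
  rcases (isPreconnected_iff_subset_of_disjoint.1 hs) u v huo hvo hsuv hdisj with h | h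
  · intro z hz
    obtain ⟨j, hj⟩ := exists_mem_openArc R (hsf hz) (hpt z hz)
    by_cases hji : j = i
    · subst hji; exact hj
    · have hzu := h hz
      rw [hu, mem_compl_iff, mem_iUnion₂] at hzu
      exact (hzu ⟨j, hji, openArc_subset_arc R j hj⟩).elim
  · exact ((h hz₀) (openArc_subset_arc R i hi)).elim

/-- If a corner `pt m` is in the closure of a set lying in the open arc `i`, then `m = i` or
`m = i + 1`. [folklore] -/
theorem eq_or_eq_of_pt_mem_closure (R : ConformalRectangle) {s : Set ℂ} {i m : Fin 4} (hs : s ⊆ openArc R i)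
    (hm : R.pt m ∈ closure s) : m = i ∨ m = i + 1 := by
  have : R.pt m ∈ R.arc i :=
    (R.isClosed_arc i).closure_subset_iff.2 (hs.trans (openArc_subset_arc R i)) hm
  exact R.pt_mem_arc_iff.1 this

/-- **Sides of the uniformizing rectangle go to open arcs.** With `Ψ` as in `exists_uniformizer`,
a connected subset `S` of the frontier of the rectangle containing no corner, whose closure
contains the corners `scrCorner k i` and `scrCorner k j` with `τ i ≠ τ j`, is mapped into the open
arc `m` with `{τ i, τ j} = {m, m + 1}`. [folklore] -/
theorem exists_image_subset_openArc (R : ConformalRectangle) (hk0 : 0 < k) (hk1 : k < 1) {Ψ : ℂ → ℂ}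
    (hΨc : ContinuousOn Ψ (closure (scrRect k))) (hΨbij : BijOn Ψ (closure (scrRect k)) (closure R.carrier))
    (hΨfr : MapsTo Ψ (frontier (scrRect k)) (frontier R.carrier)) {τ : Fin 4 ≃ Fin 4}
    (hcorner : ∀ i, Ψ (scrCorner k i) = R.pt (τ i)) {S : Set ℂ} (hS : IsPreconnected S)
    (hSf : S ⊆ frontier (scrRect k)) (hSc : ∀ i, scrCorner k i ∉ S) (hSne : S.Nonempty)
    {i j : Fin 4} (hij : τ i ≠ τ j) (hi : scrCorner k i ∈ closure S) (hj : scrCorner k j ∈ closure S) :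
    ∃ m, Ψ '' S ⊆ openArc R m ∧ ((τ i = m ∧ τ j = m + 1) ∨ (τ j = m ∧ τ i = m + 1)) := by
  have hScl : S ⊆ closure (scrRect k) := hSf.trans frontier_subset_closure
  have himg_f : Ψ '' S ⊆ frontier R.carrier := (image_mono hSf).trans hΨfr.image_subset
  have hpt : ∀ z ∈ Ψ '' S, ∀ m, z ≠ R.pt m := by
    rintro _ ⟨w, hw, rfl⟩ m heq
    have hm' : R.pt m = Ψ (scrCorner k (τ.symm m)) := by rw [hcorner, Equiv.apply_symm_apply]
    rw [hm'] at heq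
    have hc' : scrCorner k (τ.symm m) ∈ closure (scrRect k) := by
      rw [← scrQuad_carrier hk0 hk1]; exact scrCorner_mem_closure hk0 hk1 _
    have := hΨbij.injOn (hScl hw) hc' heq
    exact hSc _ (this ▸ hw)
  obtain ⟨m, hm⟩ := exists_subset_openArc R (hS.image Ψ (hΨc.mono hScl)) himg_f hpt (hSne.image Ψ)
  refine ⟨m, hm, ?_⟩
  -- corners in the closure
  have hcl : ∀ i, scrCorner k i ∈ closure S → R.pt (τ i) ∈ closure (Ψ '' S) := by
    intro i hi
    rw [← hcorner i]
    have hcS : closure S ⊆ closure (scrRect k) := closure_minimal hScl isClosed_closure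
    exact (hΨc.mono hcS).image_closure (mem_image_of_mem Ψ hi)
  have h1 := eq_or_eq_of_pt_mem_closure R hm (hcl i hi)
  have h2 := eq_or_eq_of_pt_mem_closure R hm (hcl j hj)
  rcases h1 with h1 | h1 <;> rcases h2 with h2 | h2
  · exact (hij (h1.trans h2.symm)).elim
  · exact Or.inl ⟨h1, h2⟩
  · exact Or.inr ⟨h2, h1⟩
  · exact (hij (h1.trans h2.symm)).elim

end Sides

/-! ### §U5. The uniformization theorem -/

section Main

open UpperHalfPlane (upperHalfPlaneSet)

variable {k : ℝ}

/-- A vertical open segment is preconnected. [folklore] -/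
theorem isPreconnected_vSeg (x : ℝ) (s : Set ℝ) (hs : IsPreconnected s) : IsPreconnected ({x} ×ℂ s) := by
  have : ({x} ×ℂ s) = (fun t : ℝ => (x : ℂ) + t * I) '' s := by
    ext z
    simp only [mem_reProdIm, mem_singleton_iff, mem_image]
    constructor
    · rintro ⟨h1, h2⟩
      exact ⟨z.im, h2, by apply Complex.ext <;> simp [h1]⟩
    · rintro ⟨t, ht, rfl⟩
      constructor <;> simp [ht]
  rw [this]
  exact hs.image _ (by fun_prop : Continuous fun t : ℝ => (x : ℂ) + t * I).continuousOn

/-- A horizontal open segment is preconnected. [folklore] -/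
theorem isPreconnected_hSeg (y : ℝ) (s : Set ℝ) (hs : IsPreconnected s) : IsPreconnected (s ×ℂ {y}) := by
  have : (s ×ℂ {y}) = (fun t : ℝ => (t : ℂ) + y * I) '' s := by
    ext z
    simp only [mem_reProdIm, mem_singleton_iff, mem_image]
    constructor
    · rintro ⟨h1, h2⟩
      exact ⟨z.re, h1, by apply Complex.ext <;> simp [h2]⟩
    · rintro ⟨t, ht, rfl⟩
      constructor <;> simp [ht]
  rw [this]
  exact hs.image _ (by fun_prop : Continuous fun t : ℝ => (t : ℂ) + y * I).continuousOn

/-- The frontier of an open rectangle. [folklore] -/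
theorem frontier_rect {x₀ x₁ y₀ y₁ : ℝ} (hx : x₀ < x₁) (hy : y₀ < y₁) {z : ℂ} :
    z ∈ frontier (Ioo x₀ x₁ ×ℂ Ioo y₀ y₁) ↔
      (z.re ∈ Icc x₀ x₁ ∧ (z.im = y₀ ∨ z.im = y₁)) ∨ ((z.re = x₀ ∨ z.re = x₁) ∧ z.im ∈ Icc y₀ y₁) := by
  rw [frontier_reProdIm, closure_Ioo hx.ne, closure_Ioo hy.ne, frontier_Ioo hx, frontier_Ioo hy]
  simp only [mem_union, mem_reProdIm, mem_insert_iff, mem_singleton_iff]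

/-- **Uniformization of a conformal rectangle by a rectangle** (Riemann mapping theorem,
Carathéodory's theorem, a real Möbius map and the Schwarz–Christoffel map of the rectangle; all
from the tree). For every conformal rectangle `R = (Ω; arcs 0, 1, 2, 3)` there are `a, b > 0` and a
map `Ψ` which is a continuous injection of the closed rectangle `[0,a] × [0,b]` onto `closure Ω`,
a conformal equivalence of the open rectangle onto `Ω` (holomorphic, injective, `Ψ' ≠ 0`), and
which maps the closed left and right sides into the arcs `0` and `2` (in some order), the open
sides into the corresponding open arcs, the open bottom side into the open arc `1` and the open
top side into the open arc `3`. [cite: AhlforsCA1979, Ch. 6 §1.1 Thm. 1] -/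
theorem exists_rect_uniformizer (R : ConformalRectangle) :
    ∃ (a b : ℝ) (_ : 0 < a) (_ : 0 < b) (Ψ : ℂ → ℂ) (jL jR : Fin 4),
      ContinuousOn Ψ (Icc 0 a ×ℂ Icc 0 b) ∧ InjOn Ψ (Icc 0 a ×ℂ Icc 0 b) ∧
      Ψ '' (Icc 0 a ×ℂ Icc 0 b) = closure R.carrier ∧ Ψ '' (Ioo 0 a ×ℂ Ioo 0 b) = R.carrier ∧
      DifferentiableOn ℂ Ψ (Ioo 0 a ×ℂ Ioo 0 b) ∧ (∀ z ∈ Ioo 0 a ×ℂ Ioo 0 b, deriv Ψ z ≠ 0) ∧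
      ((jL = 0 ∧ jR = 2) ∨ (jL = 2 ∧ jR = 0)) ∧
      Ψ '' ({0} ×ℂ Icc 0 b) ⊆ R.arc jL ∧ Ψ '' ({a} ×ℂ Icc 0 b) ⊆ R.arc jR ∧
      Ψ '' ({0} ×ℂ Ioo 0 b) ⊆ openArc R jL ∧ Ψ '' ({a} ×ℂ Ioo 0 b) ⊆ openArc R jR ∧
      Ψ '' (Ioo 0 a ×ℂ {0}) ⊆ openArc R 1 ∧ Ψ '' (Ioo 0 a ×ℂ {b}) ⊆ openArc R 3 := by
  obtain ⟨k, hk0, hk1, G, Ψ, τ, hτ, hΨc, hΨeq, hΨbij, hΨfr, hcorner⟩ := exists_uniformizer R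
  set K := ellipticK (k ^ 2) with hK
  set K' := ellipticK (1 - k ^ 2) with hK'
  have hKp : 0 < K := ellipticK_sq_pos hk0 hk1
  have hK'p : 0 < K' := ellipticK_one_sub_sq_pos hk0 hk1
  have hrect : scrRect k = Ioo (-K) K ×ℂ Ioo 0 K' := rfl
  have hcl : closure (scrRect k) = Icc (-K) K ×ℂ Icc 0 K' := by
    rw [hrect, closure_reProdIm, closure_Ioo (by linarith), closure_Ioo hK'p.ne]
  -- corner coordinates
  have hc0 : scrCorner k 0 = (-K : ℝ) + (K' : ℝ) * I := by simp [scrCorner, hK, hK']; ring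
  have hc1 : scrCorner k 1 = (-K : ℝ) + (0 : ℝ) * I := by simp [scrCorner, hK]
  have hc2 : scrCorner k 2 = (K : ℝ) + (0 : ℝ) * I := by simp [scrCorner, hK]
  have hc3 : scrCorner k 3 = (K : ℝ) + (K' : ℝ) * I := by simp [scrCorner, hK, hK']; ring
  have hcornerre : ∀ i, (scrCorner k i).re = -K ∨ (scrCorner k i).re = K := by
    intro i; fin_cases i <;> simp [hc0, hc1, hc2, hc3]
  have hcornerim : ∀ i, (scrCorner k i).im = 0 ∨ (scrCorner k i).im = K' := by
    intro i; fin_cases i <;> simp [hc0, hc1, hc2, hc3]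
  have hwitV : ∀ (x y : ℝ) (s : Set ℝ), ((x : ℂ) + (y : ℂ) * I ∈ ({x} ×ℂ s : Set ℂ)) ↔ y ∈ s := by
    intro x y s; simp [mem_reProdIm]
  have hwitH : ∀ (x y : ℝ) (s : Set ℝ), ((x : ℂ) + (y : ℂ) * I ∈ (s ×ℂ {y} : Set ℂ)) ↔ x ∈ s := by
    intro x y s; simp [mem_reProdIm]
  -- the four open sides and their arcs
  have hside : ∀ (S : Set ℂ), IsPreconnected S → S ⊆ frontier (scrRect k) → (∀ i, scrCorner k i ∉ S) → S.Nonempty →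
      ∀ i j : Fin 4, i ≠ j → scrCorner k i ∈ closure S → scrCorner k j ∈ closure S →
      ∃ m, Ψ '' S ⊆ openArc R m ∧ ((τ i = m ∧ τ j = m + 1) ∨ (τ j = m ∧ τ i = m + 1)) :=
    fun S hS hSf hSc hSne i j hij hi hj =>
      exists_image_subset_openArc R hk0 hk1 hΨc hΨbij hΨfr hcorner hS hSf hSc hSne
        (fun h => hij (τ.injective h)) hi hj
  -- left side: corners 1 (bottom) and 0 (top)
  obtain ⟨mL, hL, hmL⟩ := hside ({-K} ×ℂ Ioo 0 K') (isPreconnected_vSeg _ _ isPreconnected_Ioo)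
    (fun z hz => by
      rw [mem_reProdIm, mem_singleton_iff] at hz
      rw [hrect, frontier_rect (by linarith) hK'p]
      exact Or.inr ⟨Or.inl hz.1, Ioo_subset_Icc_self hz.2⟩)
    (fun i hi => by
      rw [mem_reProdIm] at hi
      rcases hcornerim i with h | h <;> [exact (lt_irrefl _ (h ▸ hi.2.1)); exact (lt_irrefl _ (h ▸ hi.2.2))])
    ⟨_, (hwitV (-K) (K' / 2) _).2 ⟨by linarith, by linarith⟩⟩
    1 0 (by decide)
    (by rw [closure_reProdIm, closure_Ioo hK'p.ne, hc1, mem_reProdIm]; simp [hK'p.le])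
    (by rw [closure_reProdIm, closure_Ioo hK'p.ne, hc0, mem_reProdIm]; simp [hK'p.le])
  -- right side: corners 2 and 3
  obtain ⟨mR, hR, hmR⟩ := hside ({K} ×ℂ Ioo 0 K') (isPreconnected_vSeg _ _ isPreconnected_Ioo)
    (fun z hz => by
      rw [mem_reProdIm, mem_singleton_iff] at hz
      rw [hrect, frontier_rect (by linarith) hK'p]
      exact Or.inr ⟨Or.inr hz.1, Ioo_subset_Icc_self hz.2⟩)
    (fun i hi => by
      rw [mem_reProdIm] at hi
      rcases hcornerim i with h | h <;> [exact (lt_irrefl _ (h ▸ hi.2.1)); exact (lt_irrefl _ (h ▸ hi.2.2))])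
    ⟨_, (hwitV K (K' / 2) _).2 ⟨by linarith, by linarith⟩⟩
    2 3 (by decide)
    (by rw [closure_reProdIm, closure_Ioo hK'p.ne, hc2, mem_reProdIm]; simp [hK'p.le])
    (by rw [closure_reProdIm, closure_Ioo hK'p.ne, hc3, mem_reProdIm]; simp [hK'p.le])
  -- bottom side: corners 1 and 2
  obtain ⟨mB, hB, hmB⟩ := hside (Ioo (-K) K ×ℂ {0}) (isPreconnected_hSeg _ _ isPreconnected_Ioo)
    (fun z hz => by
      rw [mem_reProdIm, mem_singleton_iff] at hz
      rw [hrect, frontier_rect (by linarith) hK'p]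
      exact Or.inl ⟨Ioo_subset_Icc_self hz.1, Or.inl hz.2⟩)
    (fun i hi => by
      rw [mem_reProdIm] at hi
      rcases hcornerre i with h | h <;> [exact (lt_irrefl _ (h ▸ hi.1.1)); exact (lt_irrefl _ (h ▸ hi.1.2))])
    ⟨_, (hwitH 0 0 _).2 ⟨by linarith, by linarith⟩⟩
    1 2 (by decide)
    (by rw [closure_reProdIm, closure_Ioo (by linarith), hc1, mem_reProdIm]; simp [hKp.le])
    (by rw [closure_reProdIm, closure_Ioo (by linarith), hc2, mem_reProdIm]; simp [hKp.le])
  -- top side: corners 3 and 0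
  obtain ⟨mT, hT, hmT⟩ := hside (Ioo (-K) K ×ℂ {K'}) (isPreconnected_hSeg _ _ isPreconnected_Ioo)
    (fun z hz => by
      rw [mem_reProdIm, mem_singleton_iff] at hz
      rw [hrect, frontier_rect (by linarith) hK'p]
      exact Or.inl ⟨Ioo_subset_Icc_self hz.1, Or.inr hz.2⟩)
    (fun i hi => by
      rw [mem_reProdIm] at hi
      rcases hcornerre i with h | h <;> [exact (lt_irrefl _ (h ▸ hi.1.1)); exact (lt_irrefl _ (h ▸ hi.1.2))])
    ⟨_, (hwitH 0 K' _).2 ⟨by linarith, by linarith⟩⟩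
    3 0 (by decide)
    (by rw [closure_reProdIm, closure_Ioo (by linarith), hc3, mem_reProdIm]; simp [hKp.le])
    (by rw [closure_reProdIm, closure_Ioo (by linarith), hc0, mem_reProdIm]; simp [hKp.le])
  -- identify the arcs
  have hvals : ((mL = 0 ∧ mR = 2) ∨ (mL = 2 ∧ mR = 0)) ∧ mB = 1 ∧ mT = 3 := by
    rcases hτ with rfl | rfl
    · simp only [Equiv.refl_apply] at hmL hmR hmB hmT
      refine ⟨Or.inl ⟨?_, ?_⟩, ?_, ?_⟩ <;> omega
    · simp only [Fin.revPerm_apply] at hmL hmR hmB hmT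
      have r0 : Fin.rev (0 : Fin 4) = 3 := rfl
      have r1 : Fin.rev (1 : Fin 4) = 2 := rfl
      have r2 : Fin.rev (2 : Fin 4) = 1 := rfl
      have r3 : Fin.rev (3 : Fin 4) = 0 := rfl
      rw [r0, r1] at hmL; rw [r2, r3] at hmR; rw [r1, r2] at hmB; rw [r3, r0] at hmT
      refine ⟨Or.inr ⟨?_, ?_⟩, ?_, ?_⟩ <;> omega
  obtain ⟨hLR, rfl, rfl⟩ := hvals
  -- translate to `(0, 2K) × (0, K')`
  set T : ℂ → ℂ := fun z => z - K with hTdef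
  have hT_Icc : T '' (Icc 0 (2 * K) ×ℂ Icc 0 K') = Icc (-K) K ×ℂ Icc 0 K' := by
    ext z; simp only [hTdef, mem_image, mem_reProdIm, mem_Icc]
    constructor
    · rintro ⟨w, ⟨⟨h1, h2⟩, h3, h4⟩, rfl⟩; simp; refine ⟨⟨?_, ?_⟩, h3, h4⟩ <;> linarith
    · rintro ⟨⟨h1, h2⟩, h3, h4⟩; refine ⟨z + K, ⟨⟨?_, ?_⟩, ?_, ?_⟩, by ring⟩ <;> simp <;> linarith
  have hT_Ioo : T '' (Ioo 0 (2 * K) ×ℂ Ioo 0 K') = Ioo (-K) K ×ℂ Ioo 0 K' := by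
    ext z; simp only [hTdef, mem_image, mem_reProdIm, mem_Ioo]
    constructor
    · rintro ⟨w, ⟨⟨h1, h2⟩, h3, h4⟩, rfl⟩; simp; refine ⟨⟨?_, ?_⟩, h3, h4⟩ <;> linarith
    · rintro ⟨⟨h1, h2⟩, h3, h4⟩; refine ⟨z + K, ⟨⟨?_, ?_⟩, ?_, ?_⟩, by ring⟩ <;> simp <;> linarith
  have hT_maps : ∀ (s : Set ℝ) (t : Set ℝ) (s' : Set ℝ), (∀ x, x ∈ s ↔ x - K ∈ s') → T '' (s ×ℂ t) = s' ×ℂ t := by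
    intro s t s' h
    ext z; simp only [hTdef, mem_image, mem_reProdIm]
    constructor
    · rintro ⟨w, ⟨h1, h2⟩, rfl⟩; simp; exact ⟨(h _).1 h1, h2⟩
    · rintro ⟨h1, h2⟩
      refine ⟨z + K, ⟨(h _).2 (by simpa using h1), by simpa using h2⟩, by ring⟩
  have hTc : Continuous T := by fun_prop
  have hGΨ : EqOn Ψ G (scrRect k) := hΨeq
  have hGdiff : DifferentiableOn ℂ Ψ (scrRect k) :=
    (G.differentiableOn_coe.mono (scrQuad_carrier hk0 hk1).symm.subset).congr hGΨ
  have hGbij : BijOn G (scrRect k) R.carrier :=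
    (congrArg (fun S => BijOn G S R.carrier) (scrQuad_carrier hk0 hk1)).mp G.bijOn
  have hopen' : IsOpen (scrQuad k hk0 hk1).carrier := by rw [scrQuad_carrier]; exact isOpen_Ioo.reProdIm isOpen_Ioo
  have hopen : IsOpen (scrRect k) := isOpen_Ioo.reProdIm isOpen_Ioo
  refine ⟨2 * K, K', by linarith, hK'p, Ψ ∘ T, mL, mR, ?_, ?_, ?_, ?_, ?_, ?_, hLR, ?_, ?_, ?_, ?_, ?_, ?_⟩
  · refine hΨc.comp hTc.continuousOn fun z hz => ?_
    rw [hcl, ← hT_Icc]; exact mem_image_of_mem T hz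
  · intro z hz w hw h
    have hz' : T z ∈ closure (scrRect k) := by rw [hcl, ← hT_Icc]; exact mem_image_of_mem T hz
    have hw' : T w ∈ closure (scrRect k) := by rw [hcl, ← hT_Icc]; exact mem_image_of_mem T hw
    have := hΨbij.injOn hz' hw' h
    simpa [hTdef] using this
  · rw [image_comp, hT_Icc, ← hcl]; exact hΨbij.image_eq
  · rw [image_comp, hT_Ioo, ← hrect, hGΨ.image_eq]; exact hGbij.image_eq
  · refine hGdiff.comp (by fun_prop) fun z hz => ?_
    rw [hrect, ← hT_Ioo]; exact mem_image_of_mem T hz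
  · intro z hz
    have hz' : T z ∈ scrRect k := by rw [hrect, ← hT_Ioo]; exact mem_image_of_mem T hz
    have hd : deriv (Ψ ∘ T) z = deriv Ψ (T z) := by
      show deriv (fun w => Ψ (w - K)) z = _
      exact deriv_comp_sub_const Ψ _ _
    rw [hd, (hGΨ.eventuallyEq_of_mem (hopen.mem_nhds hz')).deriv_eq]
    have hz'' : T z ∈ (scrQuad k hk0 hk1).carrier := by rw [scrQuad_carrier]; exact hz'
    exact Literature.Analysis.Complex.SCV.deriv_ne_zero_of_injOn G.differentiableOn_coe hopen' G.injOn hz''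
  · -- closed left side: image of the closure of the open side
    rw [image_comp, hT_maps {0} (Icc 0 K') {-K} (fun x => by simp only [mem_singleton_iff]; constructor <;> intro h <;> linarith)]
    have h1 : ({-K} ×ℂ Icc 0 K' : Set ℂ) = closure ({-K} ×ℂ Ioo 0 K') := by
      rw [closure_reProdIm, closure_Ioo hK'p.ne, closure_singleton]
    rw [h1]
    have hsub : closure ({-K} ×ℂ Ioo 0 K') ⊆ closure (scrRect k) := by
      rw [← h1, hcl]; intro z hz; rw [mem_reProdIm] at hz ⊢; simp at hz; exact ⟨by rw [hz.1]; constructor <;> linarith, hz.2⟩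
    exact ((hΨc.mono hsub).image_closure).trans ((R.isClosed_arc mL).closure_subset_iff.2 (hL.trans (openArc_subset_arc R mL)))
  · rw [image_comp, hT_maps {2 * K} (Icc 0 K') {K} (fun x => by simp only [mem_singleton_iff]; constructor <;> intro h <;> linarith)]
    have h1 : ({K} ×ℂ Icc 0 K' : Set ℂ) = closure ({K} ×ℂ Ioo 0 K') := by
      rw [closure_reProdIm, closure_Ioo hK'p.ne, closure_singleton]
    rw [h1]
    have hsub : closure ({K} ×ℂ Ioo 0 K') ⊆ closure (scrRect k) := by
      rw [← h1, hcl]; intro z hz; rw [mem_reProdIm] at hz ⊢; simp at hz; exact ⟨by rw [hz.1]; constructor <;> linarith, hz.2⟩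
    exact ((hΨc.mono hsub).image_closure).trans ((R.isClosed_arc mR).closure_subset_iff.2 (hR.trans (openArc_subset_arc R mR)))
  · rw [image_comp, hT_maps {0} (Ioo 0 K') {-K} (fun x => by simp only [mem_singleton_iff]; constructor <;> intro h <;> linarith)]
    exact hL
  · rw [image_comp, hT_maps {2 * K} (Ioo 0 K') {K} (fun x => by simp only [mem_singleton_iff]; constructor <;> intro h <;> linarith)]
    exact hR
  · rw [image_comp, hT_maps (Ioo 0 (2 * K)) {0} (Ioo (-K) K) (fun x => by simp only [mem_Ioo]; constructor <;> rintro ⟨h1, h2⟩ <;> constructor <;> linarith)]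
    exact hB
  · rw [image_comp, hT_maps (Ioo 0 (2 * K)) {K'} (Ioo (-K) K) (fun x => by simp only [mem_Ioo]; constructor <;> rintro ⟨h1, h2⟩ <;> constructor <;> linarith)]
    exact hT

end Main

/-! ### §U6. The extremal distance of the opposite arcs is at most the aspect ratio -/

section Modulus

open Literature.Analysis.Complex

/-- **`d_Ω(T, B) ≤ a/b`** for the uniformizing rectangle `(0,a)×(0,b)` of `exists_rect_uniformizer`
(whose vertical sides go into the arcs `T = arc 0`, `B = arc 2`): one-sided conformal invariance
of the extremal distance (`extremalDistance_image_le`), monotonicity in the sets, and the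
extremal distance `a/b` of the vertical sides of the rectangle (Ahlfors (1973), §4-2).
[cite: Ahlfors1973CI, §4-2 p. 53] -/
theorem extremalDistance_arc_le (R : ConformalRectangle) {a b : ℝ} (ha : 0 < a) (hb : 0 < b) {Ψ : ℂ → ℂ}
    {jL jR : Fin 4} (hc : ContinuousOn Ψ (Icc 0 a ×ℂ Icc 0 b)) (hinj : InjOn Ψ (Icc 0 a ×ℂ Icc 0 b))
    (himg : Ψ '' (Ioo 0 a ×ℂ Ioo 0 b) = R.carrier) (hdiff : DifferentiableOn ℂ Ψ (Ioo 0 a ×ℂ Ioo 0 b))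
    (hLR : (jL = 0 ∧ jR = 2) ∨ (jL = 2 ∧ jR = 0))
    (hL : Ψ '' ({0} ×ℂ Icc 0 b) ⊆ R.arc jL) (hR : Ψ '' ({a} ×ℂ Icc 0 b) ⊆ R.arc jR) :
    extremalDistance R.carrier (R.arc 0) (R.arc 2) ≤ ENNReal.ofReal (a / b) := by
  have hopen : IsOpen (Ioo 0 a ×ℂ Ioo (0 : ℝ) b) := isOpen_Ioo.reProdIm isOpen_Ioo
  have hcl : closure (Ioo 0 a ×ℂ Ioo (0 : ℝ) b) = Icc 0 a ×ℂ Icc 0 b := by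
    rw [closure_reProdIm, closure_Ioo ha.ne, closure_Ioo hb.ne]
  have h1 := extremalDistance_image_le (E₁ := {0} ×ℂ Icc 0 b) (E₂ := {a} ×ℂ Icc 0 b) hopen hdiff
    (hinj.mono (by rw [← hcl]; exact subset_closure)) (by rwa [hcl]) himg
  rw [extremalDistance_rectangle ha hb] at h1
  have h2 : extremalDistance R.carrier (R.arc jL) (R.arc jR) ≤
      extremalDistance R.carrier (Ψ '' ({0} ×ℂ Icc 0 b)) (Ψ '' ({a} ×ℂ Icc 0 b)) := extremalDistance_anti hL hR
  rcases hLR with ⟨rfl, rfl⟩ | ⟨rfl, rfl⟩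
  · exact h2.trans h1
  · rw [extremalDistance_comm]; exact h2.trans h1

end Modulus

/-! ### §X1. The twist homeomorphism and the model cross -/

section Twist

/-- The cut-off `χ(s) = clamp((3ρ - s)/(2ρ), 0, 1)`: `1` on `[0, ρ]`, `0` on `[3ρ, ∞)`. [folklore] -/
def twistCut (ρ s : ℝ) : ℝ := max 0 (min 1 ((3 * ρ - s) / (2 * ρ)))

/-- `twistCut` is continuous in `s`. [folklore] -/
theorem continuous_twistCut (ρ : ℝ) : Continuous (twistCut ρ) := by
  unfold twistCut; fun_prop

/-- `twistCut = 1` on `[0, ρ]`. [folklore] -/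
theorem twistCut_of_le {ρ s : ℝ} (hρ : 0 < ρ) (hs : s ≤ ρ) : twistCut ρ s = 1 := by
  unfold twistCut
  have : 1 ≤ (3 * ρ - s) / (2 * ρ) := by rw [le_div_iff₀ (by linarith)]; linarith
  rw [min_eq_left this, max_eq_right zero_le_one]

/-- `twistCut = 0` beyond `3ρ`. [folklore] -/
theorem twistCut_of_ge {ρ s : ℝ} (hρ : 0 < ρ) (hs : 3 * ρ ≤ s) : twistCut ρ s = 0 := by
  unfold twistCut
  have : (3 * ρ - s) / (2 * ρ) ≤ 0 := div_nonpos_of_nonpos_of_nonneg (by linarith) (by linarith)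
  rw [max_eq_left]
  exact (min_le_right _ _).trans this

/-- **The twist map** about `m₀`: rotation by the angle `α χ(|w - m₀|)`, i.e. by `α` on the disc
of radius `ρ`, by nothing outside the disc of radius `3ρ`, interpolating in between. It is a
radius-preserving injection. [folklore] -/
def twist (m₀ : ℂ) (α ρ : ℝ) (w : ℂ) : ℂ :=
  m₀ + (w - m₀) * Complex.exp ((α * twistCut ρ ‖w - m₀‖ : ℝ) * I)

/-- The twist map is continuous. [folklore] -/
theorem continuous_twist (m₀ : ℂ) (α ρ : ℝ) : Continuous (twist m₀ α ρ) := by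
  unfold twist
  have : Continuous fun w : ℂ => ((α * twistCut ρ ‖w - m₀‖ : ℝ) : ℂ) :=
    Complex.continuous_ofReal.comp (continuous_const.mul ((continuous_twistCut ρ).comp (by fun_prop)))
  fun_prop

/-- The twist map preserves the distance to the centre. [folklore] -/
theorem norm_twist_sub (m₀ : ℂ) (α ρ : ℝ) (w : ℂ) : ‖twist m₀ α ρ w - m₀‖ = ‖w - m₀‖ := by
  unfold twist
  rw [add_sub_cancel_left, norm_mul, Complex.norm_exp_ofReal_mul_I, mul_one]

/-- The twist map is injective. [folklore] -/
theorem twist_injective (m₀ : ℂ) (α ρ : ℝ) : Function.Injective (twist m₀ α ρ) := by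
  intro w w' h
  have hn : ‖w - m₀‖ = ‖w' - m₀‖ := by rw [← norm_twist_sub m₀ α ρ w, h, norm_twist_sub]
  unfold twist at h
  rw [hn, add_right_inj] at h
  have hne : Complex.exp ((α * twistCut ρ ‖w' - m₀‖ : ℝ) * I) ≠ 0 := Complex.exp_ne_zero _
  have := mul_right_cancel₀ hne h
  exact sub_left_inj.1 this

/-- The twist map is the identity beyond `3ρ`. [folklore] -/
theorem twist_of_ge {m₀ : ℂ} {α ρ : ℝ} (hρ : 0 < ρ) {w : ℂ} (hw : 3 * ρ ≤ ‖w - m₀‖) : twist m₀ α ρ w = w := by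
  unfold twist
  rw [twistCut_of_ge hρ hw, mul_zero, Complex.ofReal_zero, zero_mul, Complex.exp_zero, mul_one, add_sub_cancel]

/-- The twist map is the rotation by `α` within `ρ`. [folklore] -/
theorem twist_of_le {m₀ : ℂ} {α ρ : ℝ} (hρ : 0 < ρ) {w : ℂ} (hw : ‖w - m₀‖ ≤ ρ) :
    twist m₀ α ρ w = m₀ + (w - m₀) * Complex.exp (α * I) := by
  unfold twist
  rw [twistCut_of_le hρ hw, mul_one]

/-- The twist map maps the disc of radius `3ρ` into itself and fixes its complement; in
particular it maps any set containing that disc into itself. [folklore] -/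
theorem twist_mem_of_ball_subset {m₀ : ℂ} {α ρ : ℝ} (hρ : 0 < ρ) {S : Set ℂ} (hS : ball m₀ (3 * ρ) ⊆ S) {w : ℂ}
    (hw : w ∈ S) : twist m₀ α ρ w ∈ S := by
  by_cases h : 3 * ρ ≤ ‖w - m₀‖
  · rw [twist_of_ge hρ h]; exact hw
  · apply hS
    rw [mem_ball, dist_eq_norm, norm_twist_sub]
    linarith

end Twist

/-! ### §X2. The model cross in the rectangle and its image -/

section ModelCross

variable {a b : ℝ}

/-- The twisted vertical midline of `(0,a)×(0,b)`. [folklore] -/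
def vMid (a b α ρ : ℝ) (t : ℝ) : ℂ := twist ((a / 2 : ℝ) + (b / 2 : ℝ) * I) α ρ ((a / 2 : ℝ) + (t * b : ℝ) * I)

/-- The twisted horizontal midline of `(0,a)×(0,b)`. [folklore] -/
def hMid (a b α ρ : ℝ) (s : ℝ) : ℂ := twist ((a / 2 : ℝ) + (b / 2 : ℝ) * I) α ρ ((s * a : ℝ) + (b / 2 : ℝ) * I)

/-- The model curves are continuous. [folklore] -/
theorem continuous_vMid (a b α ρ : ℝ) : Continuous (vMid a b α ρ) := by
  unfold vMid
  exact (continuous_twist _ _ _).comp (by fun_prop)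

/-- The model curves are continuous. [folklore] -/
theorem continuous_hMid (a b α ρ : ℝ) : Continuous (hMid a b α ρ) := by
  unfold hMid
  exact (continuous_twist _ _ _).comp (by fun_prop)

/-- **The model curves meet only at the centre.** [folklore] -/
theorem vMid_eq_hMid_iff (ha : 0 < a) (hb : 0 < b) (α ρ : ℝ) {t s : ℝ} :
    vMid a b α ρ t = hMid a b α ρ s ↔ t = 1 / 2 ∧ s = 1 / 2 := by
  constructor
  · intro h
    have h' := twist_injective _ _ _ h
    have hre := congrArg Complex.re h'
    have him := congrArg Complex.im h'
    simp at hre him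
    constructor
    · have : t * b = b / 2 := by linarith
      field_simp at this; linarith
    · have : s * a = a / 2 := by linarith
      field_simp at this; linarith
  · rintro ⟨rfl, rfl⟩
    unfold vMid hMid
    congr 1; push_cast; ring

/-- The straight vertical midline lies in the closed rectangle, in the open one for `0 < t < 1`.
[folklore] -/
theorem vline_mem (ha : 0 < a) (hb : 0 < b) {t : ℝ} (ht : t ∈ Icc (0 : ℝ) 1) :
    ((a / 2 : ℝ) + (t * b : ℝ) * I : ℂ) ∈ Icc 0 a ×ℂ Icc 0 b := by
  rw [mem_reProdIm]
  have h1 : (((a / 2 : ℝ) : ℂ) + ((t * b : ℝ) : ℂ) * I).re = a / 2 := by simp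
  have h2 : (((a / 2 : ℝ) : ℂ) + ((t * b : ℝ) : ℂ) * I).im = t * b := by simp
  rw [h1, h2]
  exact ⟨⟨by linarith, by linarith⟩, by nlinarith [ht.1], by nlinarith [ht.2]⟩

/-- Interior points of the vertical midline. [folklore] -/
theorem vline_mem_Ioo (ha : 0 < a) (hb : 0 < b) {t : ℝ} (ht : t ∈ Ioo (0 : ℝ) 1) :
    ((a / 2 : ℝ) + (t * b : ℝ) * I : ℂ) ∈ Ioo 0 a ×ℂ Ioo 0 b := by
  rw [mem_reProdIm]
  have h1 : (((a / 2 : ℝ) : ℂ) + ((t * b : ℝ) : ℂ) * I).re = a / 2 := by simp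
  have h2 : (((a / 2 : ℝ) : ℂ) + ((t * b : ℝ) : ℂ) * I).im = t * b := by simp
  rw [h1, h2]
  exact ⟨⟨by linarith, by linarith⟩, by nlinarith [ht.1], by nlinarith [ht.2]⟩

/-- The straight horizontal midline lies in the closed rectangle. [folklore] -/
theorem hline_mem (ha : 0 < a) (hb : 0 < b) {s : ℝ} (hs : s ∈ Icc (0 : ℝ) 1) :
    ((s * a : ℝ) + (b / 2 : ℝ) * I : ℂ) ∈ Icc 0 a ×ℂ Icc 0 b := by
  rw [mem_reProdIm]
  have h1 : (((s * a : ℝ) : ℂ) + ((b / 2 : ℝ) : ℂ) * I).re = s * a := by simp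
  have h2 : (((s * a : ℝ) : ℂ) + ((b / 2 : ℝ) : ℂ) * I).im = b / 2 := by simp
  rw [h1, h2]
  exact ⟨⟨by nlinarith [hs.1], by nlinarith [hs.2]⟩, by linarith, by linarith⟩

/-- Interior points of the horizontal midline. [folklore] -/
theorem hline_mem_Ioo (ha : 0 < a) (hb : 0 < b) {s : ℝ} (hs : s ∈ Ioo (0 : ℝ) 1) :
    ((s * a : ℝ) + (b / 2 : ℝ) * I : ℂ) ∈ Ioo 0 a ×ℂ Ioo 0 b := by
  rw [mem_reProdIm]
  have h1 : (((s * a : ℝ) : ℂ) + ((b / 2 : ℝ) : ℂ) * I).re = s * a := by simp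
  have h2 : (((s * a : ℝ) : ℂ) + ((b / 2 : ℝ) : ℂ) * I).im = b / 2 := by simp
  rw [h1, h2]
  exact ⟨⟨by nlinarith [hs.1], by nlinarith [hs.2]⟩, by linarith, by linarith⟩

/-- The twisting disc lies in the open rectangle when `3ρ < min (a/2) (b/2)`. [folklore] -/
theorem ball_center_subset {ρ : ℝ} (hρa : 3 * ρ ≤ a / 2) (hρb : 3 * ρ ≤ b / 2) :
    ball ((a / 2 : ℝ) + (b / 2 : ℝ) * I : ℂ) (3 * ρ) ⊆ Ioo 0 a ×ℂ Ioo 0 b := by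
  intro z hz
  rw [mem_ball, Complex.dist_eq] at hz
  have hre := (Complex.abs_re_le_norm (z - ((a / 2 : ℝ) + (b / 2 : ℝ) * I))).trans_lt hz
  have him := (Complex.abs_im_le_norm (z - ((a / 2 : ℝ) + (b / 2 : ℝ) * I))).trans_lt hz
  simp [abs_lt] at hre him
  rw [mem_reProdIm]; constructor <;> constructor <;> linarith [hre.1, hre.2, him.1, him.2]

/-- The model vertical curve runs in the closed rectangle, with end points the midpoints of the
bottom and top sides, interior points in the open rectangle, and is the rotated straight line
near the centre. [folklore] -/
theorem vMid_props (ha : 0 < a) (hb : 0 < b) (α : ℝ) {ρ : ℝ} (hρ : 0 < ρ) (hρa : 3 * ρ ≤ a / 2) (hρb : 3 * ρ ≤ b / 2) :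
    (∀ t ∈ Icc (0 : ℝ) 1, vMid a b α ρ t ∈ Icc 0 a ×ℂ Icc 0 b) ∧
    (∀ t ∈ Ioo (0 : ℝ) 1, vMid a b α ρ t ∈ Ioo 0 a ×ℂ Ioo 0 b) ∧
    vMid a b α ρ 0 = (a / 2 : ℝ) ∧ vMid a b α ρ 1 = (a / 2 : ℝ) + (b : ℝ) * I ∧
    (∀ t, |t - 1 / 2| * b ≤ ρ → vMid a b α ρ t =
      ((a / 2 : ℝ) + (b / 2 : ℝ) * I) + (((t - 1 / 2) * b : ℝ) * I) * Complex.exp (α * I)) := by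
  have hcl : ball ((a / 2 : ℝ) + (b / 2 : ℝ) * I : ℂ) (3 * ρ) ⊆ Icc 0 a ×ℂ Icc 0 b := by
    intro z hz
    have := ball_center_subset hρa hρb hz
    rw [mem_reProdIm] at this ⊢; exact ⟨Ioo_subset_Icc_self this.1, Ioo_subset_Icc_self this.2⟩
  have hnorm : ∀ t : ℝ, ‖((a / 2 : ℝ) + (t * b : ℝ) * I : ℂ) - ((a / 2 : ℝ) + (b / 2 : ℝ) * I)‖ = |t - 1 / 2| * b := by
    intro t
    rw [show ((a / 2 : ℝ) + (t * b : ℝ) * I : ℂ) - ((a / 2 : ℝ) + (b / 2 : ℝ) * I) = (((t - 1 / 2) * b : ℝ) : ℂ) * I by push_cast; ring,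
      norm_mul, Complex.norm_I, mul_one, Complex.norm_real, Real.norm_eq_abs, abs_mul, abs_of_pos hb]
  refine ⟨fun t ht => twist_mem_of_ball_subset hρ hcl (vline_mem ha hb ht),
    fun t ht => twist_mem_of_ball_subset hρ (ball_center_subset hρa hρb) (vline_mem_Ioo ha hb ht), ?_, ?_, ?_⟩
  · unfold vMid
    rw [twist_of_ge hρ (by rw [hnorm, show |(0:ℝ) - 1 / 2| = 1 / 2 by norm_num]; linarith)]
    push_cast; ring
  · unfold vMid
    rw [twist_of_ge hρ (by rw [hnorm, show |(1:ℝ) - 1 / 2| = 1 / 2 by norm_num]; linarith)]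
    push_cast; ring
  · intro t ht
    unfold vMid
    rw [twist_of_le hρ (by rw [hnorm]; exact ht)]
    congr 1
    push_cast; ring

/-- The same for the model horizontal curve. [folklore] -/
theorem hMid_props (ha : 0 < a) (hb : 0 < b) (α : ℝ) {ρ : ℝ} (hρ : 0 < ρ) (hρa : 3 * ρ ≤ a / 2) (hρb : 3 * ρ ≤ b / 2) :
    (∀ s ∈ Icc (0 : ℝ) 1, hMid a b α ρ s ∈ Icc 0 a ×ℂ Icc 0 b) ∧
    (∀ s ∈ Ioo (0 : ℝ) 1, hMid a b α ρ s ∈ Ioo 0 a ×ℂ Ioo 0 b) ∧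
    hMid a b α ρ 0 = (b / 2 : ℝ) * I ∧ hMid a b α ρ 1 = (a : ℝ) + (b / 2 : ℝ) * I ∧
    (∀ s, |s - 1 / 2| * a ≤ ρ → hMid a b α ρ s =
      ((a / 2 : ℝ) + (b / 2 : ℝ) * I) + (((s - 1 / 2) * a : ℝ) : ℂ) * Complex.exp (α * I)) := by
  have hcl : ball ((a / 2 : ℝ) + (b / 2 : ℝ) * I : ℂ) (3 * ρ) ⊆ Icc 0 a ×ℂ Icc 0 b := by
    intro z hz
    have := ball_center_subset hρa hρb hz
    rw [mem_reProdIm] at this ⊢; exact ⟨Ioo_subset_Icc_self this.1, Ioo_subset_Icc_self this.2⟩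
  have hnorm : ∀ s : ℝ, ‖((s * a : ℝ) + (b / 2 : ℝ) * I : ℂ) - ((a / 2 : ℝ) + (b / 2 : ℝ) * I)‖ = |s - 1 / 2| * a := by
    intro s
    rw [show ((s * a : ℝ) + (b / 2 : ℝ) * I : ℂ) - ((a / 2 : ℝ) + (b / 2 : ℝ) * I) = (((s - 1 / 2) * a : ℝ) : ℂ) by push_cast; ring,
      Complex.norm_real, Real.norm_eq_abs, abs_mul, abs_of_pos ha]
  refine ⟨fun s hs => twist_mem_of_ball_subset hρ hcl (hline_mem ha hb hs),
    fun s hs => twist_mem_of_ball_subset hρ (ball_center_subset hρa hρb) (hline_mem_Ioo ha hb hs), ?_, ?_, ?_⟩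
  · unfold hMid
    rw [twist_of_ge hρ (by rw [hnorm, show |(0:ℝ) - 1 / 2| = 1 / 2 by norm_num]; linarith)]
    push_cast; ring
  · unfold hMid
    rw [twist_of_ge hρ (by rw [hnorm, show |(1:ℝ) - 1 / 2| = 1 / 2 by norm_num]; linarith)]
    push_cast; ring
  · intro s hs
    unfold hMid
    rw [twist_of_le hρ (by rw [hnorm]; exact hs)]
    congr 1
    push_cast; ring

end ModelCross

/-! ### §X3. The cross in `Ω`: the images of the model curves -/

section TargetCross

variable {a b : ℝ}

/-- **The target cross.** With `Ψ` a uniformizer of the rectangle `(0,a)×(0,b)` as in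
`exists_rect_uniformizer`, the curves `Γ_V = Ψ ∘ vMid`, `Γ_H = Ψ ∘ hMid` are continuous on
`[0,1]`, injective, run in `Ω` except for their end points, which lie on the open arcs
`1, 3` (for `Γ_V`) and `jL, jR` (for `Γ_H`), and meet only at the centre `t = s = 1/2`.
[folklore] -/
theorem cross_props (R : ConformalRectangle) (ha : 0 < a) (hb : 0 < b) {Ψ : ℂ → ℂ} {jL jR : Fin 4}
    (hc : ContinuousOn Ψ (Icc 0 a ×ℂ Icc 0 b)) (hinj : InjOn Ψ (Icc 0 a ×ℂ Icc 0 b))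
    (himg : Ψ '' (Ioo 0 a ×ℂ Ioo 0 b) = R.carrier)
    (hL : Ψ '' ({0} ×ℂ Ioo 0 b) ⊆ openArc R jL) (hRt : Ψ '' ({a} ×ℂ Ioo 0 b) ⊆ openArc R jR)
    (hB : Ψ '' (Ioo 0 a ×ℂ {0}) ⊆ openArc R 1) (hT : Ψ '' (Ioo 0 a ×ℂ {b}) ⊆ openArc R 3)
    (α : ℝ) {ρ : ℝ} (hρ : 0 < ρ) (hρa : 3 * ρ ≤ a / 2) (hρb : 3 * ρ ≤ b / 2) :
    ContinuousOn (Ψ ∘ vMid a b α ρ) (Icc 0 1) ∧ ContinuousOn (Ψ ∘ hMid a b α ρ) (Icc 0 1) ∧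
    (Ψ ∘ vMid a b α ρ) 0 ∈ openArc R 1 ∧ (Ψ ∘ vMid a b α ρ) 1 ∈ openArc R 3 ∧
    (Ψ ∘ hMid a b α ρ) 0 ∈ openArc R jL ∧ (Ψ ∘ hMid a b α ρ) 1 ∈ openArc R jR ∧
    (∀ t ∈ Ioo (0 : ℝ) 1, (Ψ ∘ vMid a b α ρ) t ∈ R.carrier) ∧ (∀ s ∈ Ioo (0 : ℝ) 1, (Ψ ∘ hMid a b α ρ) s ∈ R.carrier) ∧
    (∀ t ∈ Icc (0 : ℝ) 1, ∀ s ∈ Icc (0 : ℝ) 1, (Ψ ∘ vMid a b α ρ) t = (Ψ ∘ hMid a b α ρ) s → t = 1 / 2 ∧ s = 1 / 2) ∧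
    InjOn (Ψ ∘ vMid a b α ρ) (Icc 0 1) ∧ InjOn (Ψ ∘ hMid a b α ρ) (Icc 0 1) := by
  obtain ⟨hV1, hV2, hV0, hV1', -⟩ := vMid_props ha hb α hρ hρa hρb
  obtain ⟨hH1, hH2, hH0, hH1', -⟩ := hMid_props ha hb α hρ hρa hρb
  refine ⟨hc.comp (continuous_vMid a b α ρ).continuousOn hV1, hc.comp (continuous_hMid a b α ρ).continuousOn hH1,
    ?_, ?_, ?_, ?_, ?_, ?_, ?_, ?_, ?_⟩
  · refine hB ⟨_, ?_, by rw [Function.comp_apply, hV0]⟩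
    refine mem_reProdIm.2 ⟨?_, by simp⟩
    simp only [Complex.ofReal_re, mem_Ioo]; constructor <;> linarith
  · refine hT ⟨_, ?_, by rw [Function.comp_apply, hV1']⟩
    refine mem_reProdIm.2 ⟨?_, by simp⟩
    simp only [Complex.add_re, Complex.ofReal_re, Complex.mul_re, Complex.I_re, Complex.I_im, Complex.ofReal_im, mem_Ioo]
    constructor <;> linarith
  · refine hL ⟨_, ?_, by rw [Function.comp_apply, hH0]⟩
    refine mem_reProdIm.2 ⟨by simp, ?_⟩
    simp only [Complex.mul_im, Complex.ofReal_re, Complex.I_im, Complex.ofReal_im, Complex.I_re, mem_Ioo]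
    constructor <;> linarith
  · refine hRt ⟨_, ?_, by rw [Function.comp_apply, hH1']⟩
    refine mem_reProdIm.2 ⟨by simp, ?_⟩
    simp only [Complex.add_im, Complex.ofReal_im, Complex.mul_im, Complex.ofReal_re, Complex.I_im, Complex.I_re, mem_Ioo]
    constructor <;> linarith
  · intro t ht; rw [← himg]; exact mem_image_of_mem Ψ (hV2 t ht)
  · intro s hs; rw [← himg]; exact mem_image_of_mem Ψ (hH2 s hs)
  · intro t ht s hs h
    exact (vMid_eq_hMid_iff ha hb α ρ).1 (hinj (hV1 t ht) (hH1 s hs) h)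
  · intro t ht t' ht' h
    have h1 := hinj (hV1 t ht) (hV1 t' ht') h
    have h2 := twist_injective _ _ _ h1
    have := congrArg Complex.im h2
    simp at this
    rcases this with h | h
    · exact h
    · exact absurd h hb.ne'
  · intro s hs s' hs' h
    have h1 := hinj (hH1 s hs) (hH1 s' hs') h
    have h2 := twist_injective _ _ _ h1
    have := congrArg Complex.re h2
    simp at this
    rcases this with h | h
    · exact h
    · exact absurd h ha.ne'

/-- **Tangents of the cross at the centre.** With `α = -arg Ψ'(m₀)` the target curves have, at
the centre parameter `1/2`, the derivatives `i b ‖Ψ'(m₀)‖` (vertical) and `a ‖Ψ'(m₀)‖`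
(horizontal). [folklore] -/
theorem hasDerivAt_cross (ha : 0 < a) (hb : 0 < b) {Ψ : ℂ → ℂ} (hdiff : DifferentiableOn ℂ Ψ (Ioo 0 a ×ℂ Ioo 0 b))
    {ρ : ℝ} (hρ : 0 < ρ) (hρa : 3 * ρ ≤ a / 2) (hρb : 3 * ρ ≤ b / 2) :
    let m₀ : ℂ := (a / 2 : ℝ) + (b / 2 : ℝ) * I
    let α : ℝ := -Complex.arg (deriv Ψ m₀)
    HasDerivAt (fun t : ℝ => Ψ (vMid a b α ρ t)) ((b * ‖deriv Ψ m₀‖ : ℝ) * I) (1 / 2) ∧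
    HasDerivAt (fun s : ℝ => Ψ (hMid a b α ρ s)) ((a * ‖deriv Ψ m₀‖ : ℝ) : ℂ) (1 / 2) := by
  intro m₀ α
  have hopen : IsOpen (Ioo 0 a ×ℂ Ioo (0 : ℝ) b) := isOpen_Ioo.reProdIm isOpen_Ioo
  have hm₀ : m₀ ∈ Ioo 0 a ×ℂ Ioo 0 b := by
    refine mem_reProdIm.2 ⟨?_, ?_⟩
    · simp only [m₀, Complex.add_re, Complex.ofReal_re, Complex.mul_re, Complex.I_re, Complex.I_im, Complex.ofReal_im, mem_Ioo]
      constructor <;> linarith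
    · simp only [m₀, Complex.add_im, Complex.ofReal_im, Complex.mul_im, Complex.ofReal_re, Complex.I_im, Complex.I_re, mem_Ioo]
      constructor <;> linarith
  have hΨ : HasDerivAt Ψ (deriv Ψ m₀) m₀ := (hdiff.differentiableAt (hopen.mem_nhds hm₀)).hasDerivAt
  have hrot : deriv Ψ m₀ * Complex.exp (α * I) = (‖deriv Ψ m₀‖ : ℂ) := by
    set d := deriv Ψ m₀ with hd
    have h := Complex.norm_mul_exp_arg_mul_I d
    have hE : Complex.exp (((α : ℝ) : ℂ) * I) = (Complex.exp (Complex.arg d * I))⁻¹ := by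
      rw [← Complex.exp_neg]; simp only [α, hd]; push_cast; ring_nf
    rw [hE]
    have hne : Complex.exp (Complex.arg d * I) ≠ 0 := Complex.exp_ne_zero _
    field_simp
    rw [mul_comm]; exact h.symm
  obtain ⟨-, -, -, -, hVloc⟩ := vMid_props ha hb α hρ hρa hρb
  obtain ⟨-, -, -, -, hHloc⟩ := hMid_props ha hb α hρ hρa hρb
  constructor
  · -- vertical: near `1/2` the curve is `Ψ (m₀ + ((t - 1/2) b) I e^{iα})`
    have hloc : (fun t : ℝ => Ψ (vMid a b α ρ t)) =ᶠ[𝓝 (1 / 2 : ℝ)]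
        fun t : ℝ => Ψ (m₀ + (((t - 1 / 2) * b : ℝ) * I) * Complex.exp (α * I)) := by
      have : ∀ᶠ t : ℝ in 𝓝 (1 / 2), |t - 1 / 2| * b ≤ ρ := by
        have hε : 0 < ρ / b := div_pos hρ hb
        filter_upwards [Metric.ball_mem_nhds (1 / 2 : ℝ) hε] with t ht
        rw [Metric.mem_ball, Real.dist_eq] at ht
        have := (le_div_iff₀ hb).1 ht.le
        linarith
      filter_upwards [this] with t ht
      rw [hVloc t ht]
    refine HasDerivAt.congr_of_eventuallyEq ?_ hloc
    have hlin : HasDerivAt (fun t : ℝ => m₀ + (((t - 1 / 2) * b : ℝ) * I) * Complex.exp (α * I))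
        (((b : ℂ) * I) * Complex.exp (α * I)) (1 / 2) := by
      have h1 : HasDerivAt (fun t : ℝ => (((t - 1 / 2) * b : ℝ) : ℂ)) (b : ℂ) (1 / 2) := by
        have : HasDerivAt (fun t : ℝ => (t - 1 / 2) * b) b (1 / 2) := by
          have := ((hasDerivAt_id (1 / 2 : ℝ)).sub_const (1 / 2 : ℝ)).mul_const b
          simpa only [id_eq, one_mul] using this
        exact this.ofReal_comp
      have := ((h1.mul_const I).mul_const (Complex.exp (α * I))).const_add m₀
      simpa using this
    have hval : m₀ + ((((1 / 2 : ℝ) - 1 / 2) * b : ℝ) * I) * Complex.exp (α * I) = m₀ := by simp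
    have hΨ' : HasDerivAt Ψ (deriv Ψ m₀) (m₀ + ((((1 / 2 : ℝ) - 1 / 2) * b : ℝ) * I) * Complex.exp (α * I)) := by
      rw [hval]; exact hΨ
    have h := (hΨ'.comp (1 / 2 : ℝ) hlin).congr_deriv (g' := ((b * ‖deriv Ψ m₀‖ : ℝ) : ℂ) * I) (by
      rw [show deriv Ψ m₀ * ((b : ℂ) * I * Complex.exp (α * I)) = (b : ℂ) * I * (deriv Ψ m₀ * Complex.exp (α * I)) by ring, hrot]
      push_cast; ring)
    simpa [Function.comp_def] using h
  · have hloc : (fun s : ℝ => Ψ (hMid a b α ρ s)) =ᶠ[𝓝 (1 / 2 : ℝ)]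
        fun s : ℝ => Ψ (m₀ + (((s - 1 / 2) * a : ℝ) : ℂ) * Complex.exp (α * I)) := by
      have : ∀ᶠ s : ℝ in 𝓝 (1 / 2), |s - 1 / 2| * a ≤ ρ := by
        have hε : 0 < ρ / a := div_pos hρ ha
        filter_upwards [Metric.ball_mem_nhds (1 / 2 : ℝ) hε] with s hs
        rw [Metric.mem_ball, Real.dist_eq] at hs
        have := (le_div_iff₀ ha).1 hs.le
        linarith
      filter_upwards [this] with s hs
      rw [hHloc s hs]
    refine HasDerivAt.congr_of_eventuallyEq ?_ hloc
    have hlin : HasDerivAt (fun s : ℝ => m₀ + (((s - 1 / 2) * a : ℝ) : ℂ) * Complex.exp (α * I))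
        ((a : ℂ) * Complex.exp (α * I)) (1 / 2) := by
      have h1 : HasDerivAt (fun s : ℝ => (((s - 1 / 2) * a : ℝ) : ℂ)) (a : ℂ) (1 / 2) := by
        have : HasDerivAt (fun s : ℝ => (s - 1 / 2) * a) a (1 / 2) := by
          have := ((hasDerivAt_id (1 / 2 : ℝ)).sub_const (1 / 2 : ℝ)).mul_const a
          simpa only [id_eq, one_mul] using this
        exact this.ofReal_comp
      have := (h1.mul_const (Complex.exp (α * I))).const_add m₀
      simpa using this
    have hval : m₀ + ((((1 / 2 : ℝ) - 1 / 2) * a : ℝ) : ℂ) * Complex.exp (α * I) = m₀ := by simp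
    have hΨ' : HasDerivAt Ψ (deriv Ψ m₀) (m₀ + ((((1 / 2 : ℝ) - 1 / 2) * a : ℝ) : ℂ) * Complex.exp (α * I)) := by
      rw [hval]; exact hΨ
    have h := (hΨ'.comp (1 / 2 : ℝ) hlin).congr_deriv (g' := ((a * ‖deriv Ψ m₀‖ : ℝ) : ℂ)) (by
      rw [show deriv Ψ m₀ * ((a : ℂ) * Complex.exp (α * I)) = (a : ℂ) * (deriv Ψ m₀ * Complex.exp (α * I)) by ring, hrot]
      push_cast; ring)
    simpa [Function.comp_def] using h

end TargetCross

/-! ### §X4. First entrance into a small ball about a point of a differentiable curve -/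

section FirstHit

/-- **Linearization and first entrance (one-sided).** Let `Γ` be continuous on `[0,1]`, with
`Γ t ≠ Γ(1/2)` for `t ≠ 1/2`, differentiable at `1/2` with derivative `D ≠ 0`, and
`0 < ε ≤ 1/4`. There is `r₀ > 0` such that for every `r ∈ (0, r₀]` the first parameter
`tᵢ ∈ (0, 1/2)` with `Γ tᵢ ∈ B̄(Γ(1/2), r)` has `Γ tᵢ` on the sphere, within `4εr` of
`Γ(1/2) - r D/‖D‖`, and `Γ t` outside the closed ball for `t < tᵢ`. [folklore] -/
theorem exists_first_entrance {Γ : ℝ → ℂ} (hΓ : ContinuousOn Γ (Icc 0 1)) {D : ℂ} (hD : HasDerivAt Γ D (1 / 2)) (hD0 : D ≠ 0)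
    (hinj : ∀ t ∈ Icc (0 : ℝ) 1, Γ t = Γ (1 / 2) → t = 1 / 2) {ε : ℝ} (hε : 0 < ε) (hε1 : ε ≤ 1 / 4) :
    ∃ r₀ > 0, ∀ r, 0 < r → r ≤ r₀ → ∃ tᵢ : ℝ, 0 < tᵢ ∧ tᵢ < 1 / 2 ∧ ‖Γ tᵢ - Γ (1 / 2)‖ = r ∧
      (∀ t ∈ Ico 0 tᵢ, r < ‖Γ t - Γ (1 / 2)‖) ∧
      ‖Γ tᵢ - (Γ (1 / 2) - ((r / ‖D‖ : ℝ) : ℂ) * D)‖ ≤ 4 * ε * r := by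
  set c₀ := Γ (1 / 2) with hc₀
  have hDn : 0 < ‖D‖ := norm_pos_iff.2 hD0
  -- linearization
  have hlin : ∃ τ₀ > 0, τ₀ ≤ 1 / 2 ∧ ∀ τ : ℝ, |τ| ≤ τ₀ → ‖Γ (1 / 2 + τ) - c₀ - (τ : ℂ) * D‖ ≤ ε * |τ| * ‖D‖ := by
    have h := hD.isLittleO
    rw [Asymptotics.isLittleO_iff] at h
    have h' := @h (ε * ‖D‖) (by positivity)
    obtain ⟨τ₁, hτ₁, hball⟩ := Metric.eventually_nhds_iff_ball.1 h'
    refine ⟨min (τ₁ / 2) (1 / 2), by positivity, min_le_right _ _, fun τ hτ => ?_⟩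
    have hmem : 1 / 2 + τ ∈ ball (1 / 2 : ℝ) τ₁ := by
      rw [Metric.mem_ball, Real.dist_eq, show 1 / 2 + τ - 1 / 2 = τ by ring]
      exact lt_of_le_of_lt hτ (lt_of_le_of_lt (min_le_left _ _) (by linarith))
    have := hball _ hmem
    simp only [show (1 : ℝ) / 2 + τ - 1 / 2 = τ by ring, Real.norm_eq_abs] at this
    calc ‖Γ (1 / 2 + τ) - c₀ - (τ : ℂ) * D‖ = ‖Γ (1 / 2 + τ) - Γ (1 / 2) - τ • D‖ := by
          rw [hc₀, Complex.real_smul]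
      _ ≤ ε * ‖D‖ * |τ| := this
      _ = ε * |τ| * ‖D‖ := by ring
  obtain ⟨τ₀, hτ₀, hτ₀h, hlin⟩ := hlin
  -- positive distance away from the centre parameter
  have hfar : ∃ η₀ > 0, ∀ t ∈ Icc (0 : ℝ) 1, τ₀ ≤ |t - 1 / 2| → η₀ ≤ ‖Γ t - c₀‖ := by
    set K : Set ℝ := {t ∈ Icc (0 : ℝ) 1 | τ₀ ≤ |t - 1 / 2|} with hK
    have hKc : IsCompact K := by
      have : K = Icc (0 : ℝ) 1 ∩ (fun t => |t - 1 / 2|) ⁻¹' Ici τ₀ := by ext t; simp [hK]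
      rw [this]
      exact isCompact_Icc.inter_right (isClosed_Ici.preimage (by fun_prop))
    by_cases hKe : K.Nonempty
    · have hcont : ContinuousOn (fun t => ‖Γ t - c₀‖) K := ((hΓ.mono fun t ht => ht.1).sub continuousOn_const).norm
      obtain ⟨t₀, ht₀, hmin⟩ := hKc.exists_isMinOn hKe hcont
      have hpos : 0 < ‖Γ t₀ - c₀‖ := by
        rw [norm_pos_iff, sub_ne_zero]
        intro h
        have := hinj t₀ ht₀.1 h
        have h2 := ht₀.2
        rw [this, sub_self, abs_zero] at h2
        linarith
      exact ⟨‖Γ t₀ - c₀‖, hpos, fun t ht hτ => hmin ⟨ht, hτ⟩⟩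
    · exact ⟨1, one_pos, fun t ht hτ => (hKe ⟨t, ht, hτ⟩).elim⟩
  obtain ⟨η₀, hη₀, hfar⟩ := hfar
  refine ⟨min (η₀ / 2) (τ₀ * ‖D‖ / 4), by positivity, fun r hr hrr₀ => ?_⟩
  have hrη : r < η₀ := by linarith [min_le_left (η₀ / 2) (τ₀ * ‖D‖ / 4)]
  have hrτ : r ≤ τ₀ * ‖D‖ / 4 := hrr₀.trans (min_le_right _ _)
  -- norm comparison near the centre parameter
  have hnear : ∀ τ : ℝ, |τ| ≤ τ₀ → |(‖Γ (1 / 2 + τ) - c₀‖ - |τ| * ‖D‖)| ≤ ε * |τ| * ‖D‖ := by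
    intro τ hτ
    have h1 := hlin τ hτ
    have h2 : ‖(τ : ℂ) * D‖ = |τ| * ‖D‖ := by rw [norm_mul, Complex.norm_real, Real.norm_eq_abs]
    rw [← h2]
    exact (abs_norm_sub_norm_le (Γ (1 / 2 + τ) - c₀) ((τ : ℂ) * D)).trans h1
  -- the entrance parameter
  set S : Set ℝ := {t ∈ Icc (0 : ℝ) (1 / 2) | ‖Γ t - c₀‖ ≤ r} with hS
  have hSc : IsClosed S := by
    have : S = Icc (0 : ℝ) (1 / 2) ∩ (fun t => ‖Γ t - c₀‖) ⁻¹' Iic r := by ext t; simp [hS]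
    rw [this]
    exact ((hΓ.mono (Icc_subset_Icc_right (by norm_num))).sub continuousOn_const).norm.preimage_isClosed_of_isClosed
      isClosed_Icc isClosed_Iic
  have hhalf : (1 / 2 : ℝ) ∈ S := ⟨⟨by norm_num, le_rfl⟩, by rw [hc₀, sub_self, norm_zero]; exact hr.le⟩
  have hSbdd : BddBelow S := ⟨0, fun t ht => ht.1.1⟩
  set tᵢ := sInf S with htᵢ
  have htᵢS : tᵢ ∈ S := hSc.csInf_mem ⟨_, hhalf⟩ hSbdd
  have htᵢle : ∀ t ∈ S, tᵢ ≤ t := fun t ht => csInf_le hSbdd ht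
  -- a point just below `1/2` is in `S`, so `tᵢ < 1/2`
  set τ₁ : ℝ := r / (2 * ‖D‖) with hτ₁
  have hτ₁pos : 0 < τ₁ := by positivity
  have hτ₁D : τ₁ * ‖D‖ = r / 2 := by rw [hτ₁]; field_simp
  have hτ₁le : τ₁ ≤ τ₀ := by
    rw [hτ₁, div_le_iff₀ (by positivity)]; nlinarith
  have hτ₁S : 1 / 2 - τ₁ ∈ S := by
    refine ⟨⟨by linarith, by linarith⟩, ?_⟩
    have h := hnear (-τ₁) (by rw [abs_neg, abs_of_pos hτ₁pos]; exact hτ₁le)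
    rw [show (1 : ℝ) / 2 + -τ₁ = 1 / 2 - τ₁ by ring, abs_neg, abs_of_pos hτ₁pos, hτ₁D] at h
    have := (abs_le.1 h).2
    nlinarith
  have htᵢlt : tᵢ < 1 / 2 := lt_of_le_of_lt (htᵢle _ hτ₁S) (by linarith)
  -- before `tᵢ` the curve is outside
  have hbefore : ∀ t ∈ Ico 0 tᵢ, r < ‖Γ t - c₀‖ := by
    intro t ht
    by_contra hle
    push Not at hle
    have : t ∈ S := ⟨⟨ht.1, ht.2.le.trans htᵢS.1.2⟩, hle⟩
    exact lt_irrefl _ (ht.2.trans_le (htᵢle t this))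
  -- `tᵢ` is close to `1/2`, hence `tᵢ > 0`, on the sphere and near the antipode
  have htᵢnear : |tᵢ - 1 / 2| < τ₀ := by
    by_contra h
    push Not at h
    have := hfar tᵢ ⟨htᵢS.1.1, htᵢS.1.2.trans (by norm_num)⟩ h
    linarith [htᵢS.2]
  have htᵢpos : 0 < tᵢ := by
    by_contra h
    push Not at h
    have h0 : tᵢ = 0 := le_antisymm h htᵢS.1.1
    rw [h0, zero_sub, abs_neg, abs_of_pos (by norm_num : (0:ℝ) < 1 / 2)] at htᵢnear
    linarith
  have hsphere : ‖Γ tᵢ - c₀‖ = r := by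
    refine le_antisymm htᵢS.2 ?_
    have hcont : ContinuousWithinAt (fun t => ‖Γ t - c₀‖) (Ico 0 tᵢ) tᵢ := by
      have h1 : ContinuousWithinAt Γ (Icc 0 1) tᵢ := hΓ tᵢ ⟨htᵢS.1.1, htᵢS.1.2.trans (by norm_num)⟩
      exact ((h1.mono fun t ht => ⟨ht.1, ht.2.le.trans (htᵢS.1.2.trans (by norm_num))⟩).sub
        continuousWithinAt_const).norm
    have hmem : tᵢ ∈ closure (Ico 0 tᵢ) := by rw [closure_Ico htᵢpos.ne]; exact ⟨htᵢpos.le, le_rfl⟩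
    exact ContinuousWithinAt.closure_le hmem continuousWithinAt_const hcont fun t ht => (hbefore t ht).le
  refine ⟨tᵢ, htᵢpos, htᵢlt, hsphere, hbefore, ?_⟩
  -- the antipode estimate
  set τ := tᵢ - 1 / 2 with hτdef
  have hτneg : τ < 0 := by rw [hτdef]; linarith
  have hτabs : |τ| = -τ := abs_of_neg hτneg
  have hτle : |τ| ≤ τ₀ := htᵢnear.le
  have h1 := hlin τ hτle
  have h2 := hnear τ hτle
  rw [show (1 : ℝ) / 2 + τ = tᵢ by rw [hτdef]; ring] at h1 h2
  rw [hsphere] at h2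
  -- `| r - |τ| ‖D‖ | ≤ ε |τ| ‖D‖`, so `|τ| ‖D‖ ≤ r / (1 - ε) ≤ 2 r`
  have hτD : |τ| * ‖D‖ ≤ 2 * r := by
    have := (abs_le.1 h2).1
    nlinarith [abs_nonneg τ]
  -- `Γ tᵢ - (c₀ - (r/‖D‖) D) = (Γ tᵢ - c₀ - τ D) + (τ + r/‖D‖) D`
  have hdecomp : Γ tᵢ - (c₀ - ((r / ‖D‖ : ℝ) : ℂ) * D) = (Γ tᵢ - c₀ - (τ : ℂ) * D) + ((τ + r / ‖D‖ : ℝ) : ℂ) * D := by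
    push_cast; ring
  rw [hdecomp]
  calc ‖(Γ tᵢ - c₀ - (τ : ℂ) * D) + ((τ + r / ‖D‖ : ℝ) : ℂ) * D‖
      ≤ ‖Γ tᵢ - c₀ - (τ : ℂ) * D‖ + ‖((τ + r / ‖D‖ : ℝ) : ℂ) * D‖ := norm_add_le _ _
    _ ≤ ε * |τ| * ‖D‖ + |τ + r / ‖D‖| * ‖D‖ := by
        gcongr
        rw [norm_mul, Complex.norm_real, Real.norm_eq_abs]
    _ = ε * |τ| * ‖D‖ + |τ * ‖D‖ + r| := by
        rw [← abs_of_pos hDn, ← abs_mul, abs_of_pos hDn]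
        congr 2; field_simp
    _ = ε * |τ| * ‖D‖ + |r - |τ| * ‖D‖| := by
        rw [hτabs]; congr 1; rw [show τ * ‖D‖ + r = r - -τ * ‖D‖ by ring]
    _ ≤ ε * |τ| * ‖D‖ + ε * |τ| * ‖D‖ := by gcongr
    _ ≤ 4 * ε * r := by nlinarith [hε]

end FirstHit

section TwoSidedHit

/-- **First entrance and last exit.** Two-sided form of `exists_first_entrance` (the exit is the
entrance of the reversed curve). [folklore] -/
theorem exists_entrance_exit {Γ : ℝ → ℂ} (hΓ : ContinuousOn Γ (Icc 0 1)) {D : ℂ} (hD : HasDerivAt Γ D (1 / 2)) (hD0 : D ≠ 0)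
    (hinj : ∀ t ∈ Icc (0 : ℝ) 1, Γ t = Γ (1 / 2) → t = 1 / 2) {ε : ℝ} (hε : 0 < ε) (hε1 : ε ≤ 1 / 4) :
    ∃ r₀ > 0, ∀ r, 0 < r → r ≤ r₀ → ∃ tᵢ tₒ : ℝ, 0 < tᵢ ∧ tᵢ < 1 / 2 ∧ 1 / 2 < tₒ ∧ tₒ < 1 ∧
      ‖Γ tᵢ - Γ (1 / 2)‖ = r ∧ ‖Γ tₒ - Γ (1 / 2)‖ = r ∧
      (∀ t ∈ Ico 0 tᵢ, r < ‖Γ t - Γ (1 / 2)‖) ∧ (∀ t ∈ Ioc tₒ 1, r < ‖Γ t - Γ (1 / 2)‖) ∧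
      ‖Γ tᵢ - (Γ (1 / 2) - ((r / ‖D‖ : ℝ) : ℂ) * D)‖ ≤ 4 * ε * r ∧
      ‖Γ tₒ - (Γ (1 / 2) + ((r / ‖D‖ : ℝ) : ℂ) * D)‖ ≤ 4 * ε * r := by
  obtain ⟨r₁, hr₁, h₁⟩ := exists_first_entrance hΓ hD hD0 hinj hε hε1
  -- the reversed curve
  set Γ' : ℝ → ℂ := fun t => Γ (1 - t) with hΓ'
  have hΓ'c : ContinuousOn Γ' (Icc 0 1) :=
    hΓ.comp (by fun_prop) fun t ht => ⟨by linarith [ht.2], by linarith [ht.1]⟩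
  have hhalf : Γ' (1 / 2) = Γ (1 / 2) := by simp only [hΓ']; norm_num
  have h1mh : (1 : ℝ) - 1 / 2 = 1 / 2 := by norm_num
  have hD' : HasDerivAt Γ' (-D) (1 / 2) := by
    have h1 : HasDerivAt (fun t : ℝ => 1 - t) (-1) (1 / 2) := by simpa using (hasDerivAt_id (1 / 2 : ℝ)).const_sub 1
    have h2 : HasDerivAt Γ D (1 - 1 / 2) := by rw [h1mh]; exact hD
    have h3 := h2.scomp (1 / 2 : ℝ) h1
    have e : ((-1 : ℝ) • D) = -D := by simp
    rw [e] at h3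
    exact h3
  have hinj' : ∀ t ∈ Icc (0 : ℝ) 1, Γ' t = Γ' (1 / 2) → t = 1 / 2 := by
    intro t ht h
    rw [hhalf] at h
    have := hinj (1 - t) ⟨by linarith [ht.2], by linarith [ht.1]⟩ h
    linarith
  obtain ⟨r₂, hr₂, h₂⟩ := exists_first_entrance hΓ'c hD' (neg_ne_zero.2 hD0) hinj' hε hε1
  refine ⟨min r₁ r₂, by positivity, fun r hr hrle => ?_⟩
  obtain ⟨tᵢ, h1, h2, h3, h4, h5⟩ := h₁ r hr (hrle.trans (min_le_left _ _))
  obtain ⟨sᵢ, g1, g2, g3, g4, g5⟩ := h₂ r hr (hrle.trans (min_le_right _ _))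
  refine ⟨tᵢ, 1 - sᵢ, h1, h2, by linarith, by linarith, h3, ?_, h4, ?_, h5, ?_⟩
  · rw [hhalf] at g3; exact g3
  · intro t ht
    have := g4 (1 - t) ⟨by linarith [ht.2], by linarith [ht.1]⟩
    rw [hhalf] at this
    simpa only [hΓ', sub_sub_cancel] using this
  · have : Γ' sᵢ - (Γ' (1 / 2) - ((r / ‖-D‖ : ℝ) : ℂ) * -D) = Γ (1 - sᵢ) - (Γ (1 / 2) + ((r / ‖D‖ : ℝ) : ℂ) * D) := by
      rw [hhalf, norm_neg]; simp only [hΓ']; ring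
    rw [← this]; exact g5

end TwoSidedHit

/-! ### §X5. The cross data: curves, small ball, entrance/exit points, straight axes -/

section CrossData

open MeasureTheory

/-- Non-dyadic reals exist in every interval (the dyadic rationals are countable, hence null).
[folklore] -/
theorem exists_not_dyadic {u v : ℝ} (huv : u < v) : ∃ x ∈ Ioo u v, ∀ (n : ℕ) (m : ℤ), x ≠ m / 2 ^ n := by
  set Dy : Set ℝ := ⋃ n : ℕ, ⋃ m : ℤ, {((m : ℝ) / 2 ^ n)} with hDy
  have hc : Dy.Countable := countable_iUnion fun n => countable_iUnion fun m => countable_singleton _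
  have hnull : volume Dy = 0 := hc.measure_zero volume
  have hpos : volume (Ioo u v) ≠ 0 := by rw [Real.volume_Ioo]; exact (ENNReal.ofReal_pos.2 (by linarith)).ne'
  have : ¬ Ioo u v ⊆ Dy := fun h => hpos (measure_mono_null h hnull)
  obtain ⟨x, hx, hxD⟩ := not_subset.1 this
  refine ⟨x, hx, fun n m h => hxD ?_⟩
  rw [hDy]; exact mem_iUnion.2 ⟨n, mem_iUnion.2 ⟨m, h⟩⟩

/-- **The cross data of a conformal rectangle.** For the uniformizer `Ψ` of
`exists_rect_uniformizer` there are: two curves `Γ_V` (from the open arc `1` to the open arc `3`)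
and `Γ_H` (from the open arc `jL` to the open arc `jR`), continuous on `[0,1]`, running in `Ω`,
meeting only at the centre `c₀ = Γ_V(1/2) = Γ_H(1/2)`; a radius `r > 0` with `B̄(c₀, r) ⊆ Ω`;
entrance and exit parameters `tᵢ < 1/2 < tₒ`, `sᵢ < 1/2 < sₒ` of the closed ball, before/after
which the curves are outside it, with the entrance/exit points within `r/5` of the bottom/top
(for `Γ_V`) and left/right (for `Γ_H`) points of the sphere; and non-dyadic axis coordinates
`x*, y*` within `r/5` of those of `c₀`. `Γ_V` avoids the arcs `0` and `2`. [folklore] -/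
theorem exists_cross_data (R : ConformalRectangle) {a b : ℝ} (ha : 0 < a) (hb : 0 < b) {Ψ : ℂ → ℂ} {jL jR : Fin 4}
    (hc : ContinuousOn Ψ (Icc 0 a ×ℂ Icc 0 b)) (hinj : InjOn Ψ (Icc 0 a ×ℂ Icc 0 b))
    (himg : Ψ '' (Ioo 0 a ×ℂ Ioo 0 b) = R.carrier) (hdiff : DifferentiableOn ℂ Ψ (Ioo 0 a ×ℂ Ioo 0 b))
    (hderiv : ∀ z ∈ Ioo 0 a ×ℂ Ioo 0 b, deriv Ψ z ≠ 0)
    (hL : Ψ '' ({0} ×ℂ Ioo 0 b) ⊆ openArc R jL) (hRt : Ψ '' ({a} ×ℂ Ioo 0 b) ⊆ openArc R jR)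
    (hB : Ψ '' (Ioo 0 a ×ℂ {0}) ⊆ openArc R 1) (hT : Ψ '' (Ioo 0 a ×ℂ {b}) ⊆ openArc R 3) :
    ∃ (ΓV ΓH : ℝ → ℂ) (c₀ : ℂ) (r xs ys tᵢ tₒ sᵢ sₒ : ℝ),
      ContinuousOn ΓV (Icc 0 1) ∧ ContinuousOn ΓH (Icc 0 1) ∧
      ΓV 0 ∈ openArc R 1 ∧ ΓV 1 ∈ openArc R 3 ∧ ΓH 0 ∈ openArc R jL ∧ ΓH 1 ∈ openArc R jR ∧
      (∀ t ∈ Ioo (0 : ℝ) 1, ΓV t ∈ R.carrier) ∧ (∀ s ∈ Ioo (0 : ℝ) 1, ΓH s ∈ R.carrier) ∧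
      (∀ t ∈ Icc (0 : ℝ) 1, ∀ s ∈ Icc (0 : ℝ) 1, ΓV t = ΓH s → t = 1 / 2 ∧ s = 1 / 2) ∧
      ΓV (1 / 2) = c₀ ∧ ΓH (1 / 2) = c₀ ∧ (∀ t ∈ Icc (0 : ℝ) 1, ΓV t ∉ R.arc 0 ∧ ΓV t ∉ R.arc 2) ∧
      0 < r ∧ closedBall c₀ r ⊆ R.carrier ∧
      0 < tᵢ ∧ tᵢ < 1 / 2 ∧ 1 / 2 < tₒ ∧ tₒ < 1 ∧ 0 < sᵢ ∧ sᵢ < 1 / 2 ∧ 1 / 2 < sₒ ∧ sₒ < 1 ∧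
      ‖ΓV tᵢ - c₀‖ = r ∧ ‖ΓV tₒ - c₀‖ = r ∧ ‖ΓH sᵢ - c₀‖ = r ∧ ‖ΓH sₒ - c₀‖ = r ∧
      (∀ t ∈ Ico 0 tᵢ, r < ‖ΓV t - c₀‖) ∧ (∀ t ∈ Ioc tₒ 1, r < ‖ΓV t - c₀‖) ∧
      (∀ s ∈ Ico 0 sᵢ, r < ‖ΓH s - c₀‖) ∧ (∀ s ∈ Ioc sₒ 1, r < ‖ΓH s - c₀‖) ∧
      ‖ΓV tᵢ - (c₀ - (r : ℂ) * I)‖ ≤ r / 5 ∧ ‖ΓV tₒ - (c₀ + (r : ℂ) * I)‖ ≤ r / 5 ∧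
      ‖ΓH sᵢ - (c₀ - (r : ℂ))‖ ≤ r / 5 ∧ ‖ΓH sₒ - (c₀ + (r : ℂ))‖ ≤ r / 5 ∧
      |xs - c₀.re| < r / 5 ∧ |ys - c₀.im| < r / 5 ∧
      (∀ (n : ℕ) (m : ℤ), xs ≠ m / 2 ^ n) ∧ (∀ (n : ℕ) (m : ℤ), ys ≠ m / 2 ^ n) := by
  -- the model radius
  set ρ : ℝ := min a b / 12 with hρ
  have hρ0 : 0 < ρ := by rw [hρ]; positivity
  have hρa : 3 * ρ ≤ a / 2 := by rw [hρ]; linarith [min_le_left a b]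
  have hρb : 3 * ρ ≤ b / 2 := by rw [hρ]; linarith [min_le_right a b]
  set m₀ : ℂ := (a / 2 : ℝ) + (b / 2 : ℝ) * I with hm₀
  set α : ℝ := -Complex.arg (deriv Ψ m₀) with hα
  obtain ⟨hVc, hHc, hV0, hV1, hH0, hH1, hVΩ, hHΩ, hmeet, hVinj, hHinj⟩ :=
    cross_props R ha hb hc hinj himg hL hRt hB hT α hρ0 hρa hρb
  obtain ⟨hDV, hDH⟩ := hasDerivAt_cross ha hb hdiff hρ0 hρa hρb
  set ΓV : ℝ → ℂ := Ψ ∘ vMid a b α ρ with hΓV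
  set ΓH : ℝ → ℂ := Ψ ∘ hMid a b α ρ with hΓH
  have hopen : IsOpen (Ioo 0 a ×ℂ Ioo (0 : ℝ) b) := isOpen_Ioo.reProdIm isOpen_Ioo
  have hm₀mem : m₀ ∈ Ioo 0 a ×ℂ Ioo 0 b := by
    refine mem_reProdIm.2 ⟨?_, ?_⟩
    · simp only [hm₀, Complex.add_re, Complex.ofReal_re, Complex.mul_re, Complex.I_re, Complex.I_im, Complex.ofReal_im, mem_Ioo]
      constructor <;> linarith
    · simp only [hm₀, Complex.add_im, Complex.ofReal_im, Complex.mul_im, Complex.ofReal_re, Complex.I_im, Complex.I_re, mem_Ioo]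
      constructor <;> linarith
  have hdn : 0 < ‖deriv Ψ m₀‖ := norm_pos_iff.2 (hderiv m₀ hm₀mem)
  -- the centre
  have hV12 : vMid a b α ρ (1 / 2) = m₀ := by
    obtain ⟨-, -, -, -, h⟩ := vMid_props ha hb α hρ0 hρa hρb
    rw [h (1 / 2) (by norm_num; exact hρ0.le), hm₀]; push_cast; ring
  have hH12 : hMid a b α ρ (1 / 2) = m₀ := by
    obtain ⟨-, -, -, -, h⟩ := hMid_props ha hb α hρ0 hρa hρb
    rw [h (1 / 2) (by norm_num; exact hρ0.le), hm₀]; push_cast; ring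
  set c₀ := Ψ m₀ with hc₀
  have hΓV12 : ΓV (1 / 2) = c₀ := by rw [hΓV, Function.comp_apply, hV12]
  have hΓH12 : ΓH (1 / 2) = c₀ := by rw [hΓH, Function.comp_apply, hH12]
  have hc₀Ω : c₀ ∈ R.carrier := by rw [← himg]; exact mem_image_of_mem Ψ hm₀mem
  -- entrance/exit for both curves
  have hDV0 : ((b * ‖deriv Ψ m₀‖ : ℝ) : ℂ) * I ≠ 0 := mul_ne_zero (by exact_mod_cast (by positivity : b * ‖deriv Ψ m₀‖ ≠ 0)) Complex.I_ne_zero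
  have hDH0 : ((a * ‖deriv Ψ m₀‖ : ℝ) : ℂ) ≠ 0 := by exact_mod_cast (by positivity : a * ‖deriv Ψ m₀‖ ≠ 0)
  have hinjV : ∀ t ∈ Icc (0 : ℝ) 1, ΓV t = ΓV (1 / 2) → t = 1 / 2 := fun t ht h => hVinj ht ⟨by norm_num, by norm_num⟩ h
  have hinjH : ∀ s ∈ Icc (0 : ℝ) 1, ΓH s = ΓH (1 / 2) → s = 1 / 2 := fun s hs h => hHinj hs ⟨by norm_num, by norm_num⟩ h
  obtain ⟨r₁, hr₁, hhitV⟩ := exists_entrance_exit hVc hDV hDV0 hinjV (by norm_num : (0:ℝ) < 1 / 20) (by norm_num)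
  obtain ⟨r₂, hr₂, hhitH⟩ := exists_entrance_exit hHc hDH hDH0 hinjH (by norm_num : (0:ℝ) < 1 / 20) (by norm_num)
  -- a ball inside `Ω`
  obtain ⟨r₃, hr₃, hball⟩ := Metric.isOpen_iff.1 R.isOpen c₀ hc₀Ω
  set r : ℝ := min (min r₁ r₂) (r₃ / 2) with hr
  have hr0 : 0 < r := by rw [hr]; positivity
  have hrr₁ : r ≤ r₁ := (min_le_left _ _).trans (min_le_left _ _)
  have hrr₂ : r ≤ r₂ := (min_le_left _ _).trans (min_le_right _ _)
  have hrr₃ : r < r₃ := by rw [hr]; linarith [min_le_right (min r₁ r₂) (r₃ / 2)]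
  obtain ⟨tᵢ, tₒ, ht1, ht2, ht3, ht4, hVsi, hVso, hVbefore, hVafter, hVanti, hVanto⟩ := hhitV r hr0 hrr₁
  obtain ⟨sᵢ, sₒ, hs1, hs2, hs3, hs4, hHsi, hHso, hHbefore, hHafter, hHanti, hHanto⟩ := hhitH r hr0 hrr₂
  -- axis coordinates
  obtain ⟨xs, hxs, hxsnd⟩ := exists_not_dyadic (show c₀.re - r / 5 < c₀.re + r / 5 by linarith)
  obtain ⟨ys, hys, hysnd⟩ := exists_not_dyadic (show c₀.im - r / 5 < c₀.im + r / 5 by linarith)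
  -- unit vectors
  have hunitV : ((r / ‖((b * ‖deriv Ψ m₀‖ : ℝ) : ℂ) * I‖ : ℝ) : ℂ) * (((b * ‖deriv Ψ m₀‖ : ℝ) : ℂ) * I) = (r : ℂ) * I := by
    have hn : ‖((b * ‖deriv Ψ m₀‖ : ℝ) : ℂ) * I‖ = b * ‖deriv Ψ m₀‖ := by
      rw [norm_mul, Complex.norm_I, mul_one, Complex.norm_real, Real.norm_eq_abs, abs_of_pos (by positivity)]
    rw [hn]
    have hb' : (b : ℂ) ≠ 0 := by exact_mod_cast hb.ne'
    have hd' : ((‖deriv Ψ m₀‖ : ℝ) : ℂ) ≠ 0 := by exact_mod_cast hdn.ne'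
    push_cast
    field_simp
  have hunitH : ((r / ‖((a * ‖deriv Ψ m₀‖ : ℝ) : ℂ)‖ : ℝ) : ℂ) * ((a * ‖deriv Ψ m₀‖ : ℝ) : ℂ) = (r : ℂ) := by
    have hn : ‖((a * ‖deriv Ψ m₀‖ : ℝ) : ℂ)‖ = a * ‖deriv Ψ m₀‖ := by
      rw [Complex.norm_real, Real.norm_eq_abs, abs_of_pos (by positivity)]
    rw [hn]
    have ha' : (a : ℂ) ≠ 0 := by exact_mod_cast ha.ne'
    have hd' : ((‖deriv Ψ m₀‖ : ℝ) : ℂ) ≠ 0 := by exact_mod_cast hdn.ne'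
    push_cast
    field_simp
  rw [hunitV, hΓV12] at hVanti hVanto
  rw [hunitH, hΓH12] at hHanti hHanto
  rw [hΓV12] at hVsi hVso hVbefore hVafter
  rw [hΓH12] at hHsi hHso hHbefore hHafter
  refine ⟨ΓV, ΓH, c₀, r, xs, ys, tᵢ, tₒ, sᵢ, sₒ, hVc, hHc, hV0, hV1, hH0, hH1, hVΩ, hHΩ, hmeet, hΓV12, hΓH12, ?_,
    hr0, ?_, ht1, ht2, ht3, ht4, hs1, hs2, hs3, hs4, hVsi, hVso, hHsi, hHso, hVbefore, hVafter, hHbefore, hHafter,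
    by linarith [hVanti], by linarith [hVanto], by linarith [hHanti], by linarith [hHanto], ?_, ?_, hxsnd, hysnd⟩
  · -- `Γ_V` avoids the arcs `0`, `2`
    intro t ht
    have hfr : ∀ j : Fin 4, ∀ z ∈ R.carrier, z ∉ R.arc j := fun j z hz hzj =>
      (Set.disjoint_left.1 R.disjoint_carrier_frontier) hz (R.arc_subset_frontier j hzj)
    rcases ht.1.eq_or_lt with h0 | h0
    · rw [← h0]
      exact ⟨fun h => Set.disjoint_left.1 (openArc_disjoint_arc R (by decide : (0 : Fin 4) ≠ 1)) hV0 h,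
        fun h => Set.disjoint_left.1 (openArc_disjoint_arc R (by decide : (2 : Fin 4) ≠ 1)) hV0 h⟩
    rcases ht.2.lt_or_eq with h1 | h1
    · exact ⟨hfr 0 _ (hVΩ t ⟨h0, h1⟩), hfr 2 _ (hVΩ t ⟨h0, h1⟩)⟩
    · rw [h1]
      exact ⟨fun h => Set.disjoint_left.1 (openArc_disjoint_arc R (by decide : (0 : Fin 4) ≠ 3)) hV1 h,
        fun h => Set.disjoint_left.1 (openArc_disjoint_arc R (by decide : (2 : Fin 4) ≠ 3)) hV1 h⟩
  · exact (closedBall_subset_ball hrr₃).trans hball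
  · rw [abs_lt]; constructor <;> linarith [hxs.1, hxs.2]
  · rw [abs_lt]; constructor <;> linarith [hys.1, hys.2]

end CrossData

/-! ### §X6. Separation of the pieces of the cross (planar geometry) -/

section CrossSeparation

open Complex

/-- Coordinates along a segment are between those of the end points. [folklore] -/
theorem im_mem_uIcc_of_mem_segment {P Q z : ℂ} (hz : z ∈ segment ℝ P Q) :
    min P.im Q.im ≤ z.im ∧ z.im ≤ max P.im Q.im := by
  obtain ⟨a, b, ha, hb, hab, rfl⟩ := hz
  simp only [add_im, smul_im, smul_eq_mul]
  have h1 := mul_le_mul_of_nonneg_left (min_le_left P.im Q.im) ha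
  have h2 := mul_le_mul_of_nonneg_left (min_le_right P.im Q.im) hb
  have h3 := mul_le_mul_of_nonneg_left (le_max_left P.im Q.im) ha
  have h4 := mul_le_mul_of_nonneg_left (le_max_right P.im Q.im) hb
  have e1 : a * min P.im Q.im + b * min P.im Q.im = min P.im Q.im := by rw [← add_mul, hab, one_mul]
  have e2 : a * max P.im Q.im + b * max P.im Q.im = max P.im Q.im := by rw [← add_mul, hab, one_mul]
  constructor <;> linarith

/-- Coordinates along a segment are between those of the end points. [folklore] -/
theorem re_mem_uIcc_of_mem_segment {P Q z : ℂ} (hz : z ∈ segment ℝ P Q) :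
    min P.re Q.re ≤ z.re ∧ z.re ≤ max P.re Q.re := by
  obtain ⟨a, b, ha, hb, hab, rfl⟩ := hz
  simp only [add_re, smul_re, smul_eq_mul]
  have h1 := mul_le_mul_of_nonneg_left (min_le_left P.re Q.re) ha
  have h2 := mul_le_mul_of_nonneg_left (min_le_right P.re Q.re) hb
  have h3 := mul_le_mul_of_nonneg_left (le_max_left P.re Q.re) ha
  have h4 := mul_le_mul_of_nonneg_left (le_max_right P.re Q.re) hb
  have e1 : a * min P.re Q.re + b * min P.re Q.re = min P.re Q.re := by rw [← add_mul, hab, one_mul]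
  have e2 : a * max P.re Q.re + b * max P.re Q.re = max P.re Q.re := by rw [← add_mul, hab, one_mul]
  constructor <;> linarith

/-- **Strict convexity of discs along segments**: a point of `[P, Q]` other than `P`, with
`‖P - c‖ ≤ r` and `‖Q - c‖ < r`, lies in the open disc. [folklore] -/
theorem norm_sub_lt_of_mem_segment {P Q z c : ℂ} {r : ℝ} (hP : ‖P - c‖ ≤ r) (hQ : ‖Q - c‖ < r)
    (hz : z ∈ segment ℝ P Q) (hzP : z ≠ P) : ‖z - c‖ < r := by
  obtain ⟨a, b, ha, hb, hab, rfl⟩ := hz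
  have hb0 : 0 < b := by
    rcases hb.eq_or_lt with h | h
    · exfalso; apply hzP
      rw [← h] at hab ⊢
      simp only [add_zero] at hab
      rw [hab]; simp
    · exact h
  have : a • P + b • Q - c = a • (P - c) + b • (Q - c) := by
    calc a • P + b • Q - c = a • P + b • Q - (a + b) • c := by rw [hab, one_smul]
      _ = a • (P - c) + b • (Q - c) := by rw [add_smul, smul_sub, smul_sub]; abel
  rw [this]
  calc ‖a • (P - c) + b • (Q - c)‖ ≤ ‖a • (P - c)‖ + ‖b • (Q - c)‖ := norm_add_le _ _
    _ = a * ‖P - c‖ + b * ‖Q - c‖ := by rw [norm_smul, norm_smul, Real.norm_of_nonneg ha, Real.norm_of_nonneg hb]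
    _ < a * r + b * r := by
        have h1 : a * ‖P - c‖ ≤ a * r := mul_le_mul_of_nonneg_left hP ha
        have h2 : b * ‖Q - c‖ < b * r := mul_lt_mul_of_pos_left hQ hb0
        linarith
    _ = r := by rw [← add_mul, hab, one_mul]

/-- Segments with end points in a closed disc lie in it. [folklore] -/
theorem segment_subset_closedBall' {P Q c : ℂ} {r : ℝ} (hP : ‖P - c‖ ≤ r) (hQ : ‖Q - c‖ ≤ r) :
    segment ℝ P Q ⊆ closedBall c r :=
  (convex_closedBall c r).segment_subset (mem_closedBall_iff_norm.2 hP) (mem_closedBall_iff_norm.2 hQ)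



/-- Upper bound of the imaginary part along a segment. [folklore] -/
theorem im_le_of_mem_segment {P Q z : ℂ} (hz : z ∈ segment ℝ P Q) {m : ℝ} (hP : P.im ≤ m) (hQ : Q.im ≤ m) : z.im ≤ m :=
  (im_mem_uIcc_of_mem_segment hz).2.trans (max_le hP hQ)

/-- Lower bound of the imaginary part along a segment. [folklore] -/
theorem le_im_of_mem_segment {P Q z : ℂ} (hz : z ∈ segment ℝ P Q) {m : ℝ} (hP : m ≤ P.im) (hQ : m ≤ Q.im) : m ≤ z.im :=
  (le_min hP hQ).trans (im_mem_uIcc_of_mem_segment hz).1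

/-- Upper bound of the real part along a segment. [folklore] -/
theorem re_le_of_mem_segment {P Q z : ℂ} (hz : z ∈ segment ℝ P Q) {m : ℝ} (hP : P.re ≤ m) (hQ : Q.re ≤ m) : z.re ≤ m :=
  (re_mem_uIcc_of_mem_segment hz).2.trans (max_le hP hQ)

/-- Lower bound of the real part along a segment. [folklore] -/
theorem le_re_of_mem_segment {P Q z : ℂ} (hz : z ∈ segment ℝ P Q) {m : ℝ} (hP : m ≤ P.re) (hQ : m ≤ Q.re) : m ≤ z.re :=
  (le_min hP hQ).trans (re_mem_uIcc_of_mem_segment hz).1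

/-- `|re|, |im| ≤ norm` consequences. [folklore] -/
theorem re_im_bounds_of_norm_le {z w : ℂ} {ρ : ℝ} (h : ‖z - w‖ ≤ ρ) :
    w.re - ρ ≤ z.re ∧ z.re ≤ w.re + ρ ∧ w.im - ρ ≤ z.im ∧ z.im ≤ w.im + ρ := by
  have h1 := abs_le.1 ((Complex.abs_re_le_norm (z - w)).trans h)
  have h2 := abs_le.1 ((Complex.abs_im_le_norm (z - w)).trans h)
  simp only [sub_re, sub_im] at h1 h2
  exact ⟨by linarith [h1.1], by linarith [h1.2], by linarith [h2.1], by linarith [h2.2]⟩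

set_option maxHeartbeats 1000000 in
/-- **Separation package for the cross.** With the data of `exists_cross_data` (entrance/exit
points of the two curves on the circle `‖z - c₀‖ = r` near the four cardinal points, the curves
outside the closed disc before/after, meeting only at the centre), the straightened pieces
`A₂ = [Γ_V tᵢ, Q_v⁻]`, `A₃ = [Q_v⁻, Q_v⁺]`, `A₄ = [Q_v⁺, Γ_V tₒ]` (`Q_v^∓ = xs + (c₀.im ∓ r/2) i`) and
`B₂, B₃, B₄` (horizontal analogues at height `ys`) satisfy: the `A`-pieces other than `A₃` miss all
`B`-pieces, the `B`-pieces other than `B₃` miss all `A`-pieces, and the straight pieces lie in the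
closed disc. [folklore] -/
theorem cross_separation {ΓV ΓH : ℝ → ℂ} {c₀ : ℂ} {r xs ys tᵢ tₒ sᵢ sₒ : ℝ}
    (hmeet : ∀ t ∈ Icc (0 : ℝ) 1, ∀ s ∈ Icc (0 : ℝ) 1, ΓV t = ΓH s → t = 1 / 2 ∧ s = 1 / 2)
    (hr : 0 < r) (htᵢ : 0 < tᵢ) (htᵢ' : tᵢ < 1 / 2) (htₒ' : 1 / 2 < tₒ) (htₒ : tₒ < 1)
    (hsᵢ : 0 < sᵢ) (hsᵢ' : sᵢ < 1 / 2) (hsₒ' : 1 / 2 < sₒ) (hsₒ : sₒ < 1)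
    (hnVi : ‖ΓV tᵢ - c₀‖ = r) (hnVo : ‖ΓV tₒ - c₀‖ = r) (hnHi : ‖ΓH sᵢ - c₀‖ = r) (hnHo : ‖ΓH sₒ - c₀‖ = r)
    (houtV1 : ∀ t ∈ Ico 0 tᵢ, r < ‖ΓV t - c₀‖) (houtV2 : ∀ t ∈ Ioc tₒ 1, r < ‖ΓV t - c₀‖)
    (houtH1 : ∀ s ∈ Ico 0 sᵢ, r < ‖ΓH s - c₀‖) (houtH2 : ∀ s ∈ Ioc sₒ 1, r < ‖ΓH s - c₀‖)
    (hclVi : ‖ΓV tᵢ - (c₀ - (r : ℂ) * I)‖ ≤ r / 5) (hclVo : ‖ΓV tₒ - (c₀ + (r : ℂ) * I)‖ ≤ r / 5)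
    (hclHi : ‖ΓH sᵢ - (c₀ - (r : ℂ))‖ ≤ r / 5) (hclHo : ‖ΓH sₒ - (c₀ + (r : ℂ))‖ ≤ r / 5)
    (hxs : |xs - c₀.re| < r / 5) (hys : |ys - c₀.im| < r / 5) :
    Disjoint (ΓV '' Icc 0 tᵢ ∪ segment ℝ (ΓV tᵢ) ⟨xs, c₀.im - r / 2⟩ ∪ segment ℝ ⟨xs, c₀.im + r / 2⟩ (ΓV tₒ) ∪ ΓV '' Icc tₒ 1)
      (ΓH '' Icc 0 sᵢ ∪ segment ℝ (ΓH sᵢ) ⟨c₀.re - r / 2, ys⟩ ∪ segment ℝ ⟨c₀.re - r / 2, ys⟩ ⟨c₀.re + r / 2, ys⟩ ∪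
        segment ℝ ⟨c₀.re + r / 2, ys⟩ (ΓH sₒ) ∪ ΓH '' Icc sₒ 1) ∧
    Disjoint (ΓH '' Icc 0 sᵢ ∪ segment ℝ (ΓH sᵢ) ⟨c₀.re - r / 2, ys⟩ ∪ segment ℝ ⟨c₀.re + r / 2, ys⟩ (ΓH sₒ) ∪ ΓH '' Icc sₒ 1)
      (ΓV '' Icc 0 tᵢ ∪ segment ℝ (ΓV tᵢ) ⟨xs, c₀.im - r / 2⟩ ∪ segment ℝ ⟨xs, c₀.im - r / 2⟩ ⟨xs, c₀.im + r / 2⟩ ∪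
        segment ℝ ⟨xs, c₀.im + r / 2⟩ (ΓV tₒ) ∪ ΓV '' Icc tₒ 1) ∧
    (segment ℝ (ΓV tᵢ) ⟨xs, c₀.im - r / 2⟩ ∪ segment ℝ ⟨xs, c₀.im - r / 2⟩ ⟨xs, c₀.im + r / 2⟩ ∪
      segment ℝ ⟨xs, c₀.im + r / 2⟩ (ΓV tₒ) ⊆ closedBall c₀ r) ∧
    (segment ℝ (ΓH sᵢ) ⟨c₀.re - r / 2, ys⟩ ∪ segment ℝ ⟨c₀.re - r / 2, ys⟩ ⟨c₀.re + r / 2, ys⟩ ∪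
      segment ℝ ⟨c₀.re + r / 2, ys⟩ (ΓH sₒ) ⊆ closedBall c₀ r) := by
  -- names
  set Qvm : ℂ := ⟨xs, c₀.im - r / 2⟩ with hQvm
  set Qvp : ℂ := ⟨xs, c₀.im + r / 2⟩ with hQvp
  set Qhm : ℂ := ⟨c₀.re - r / 2, ys⟩ with hQhm
  set Qhp : ℂ := ⟨c₀.re + r / 2, ys⟩ with hQhp
  set A1 := ΓV '' Icc 0 tᵢ with hA1
  set A2 := segment ℝ (ΓV tᵢ) Qvm with hA2
  set A3 := segment ℝ Qvm Qvp with hA3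
  set A4 := segment ℝ Qvp (ΓV tₒ) with hA4
  set A5 := ΓV '' Icc tₒ 1 with hA5
  set B1 := ΓH '' Icc 0 sᵢ with hB1
  set B2 := segment ℝ (ΓH sᵢ) Qhm with hB2
  set B3 := segment ℝ Qhm Qhp with hB3
  set B4 := segment ℝ Qhp (ΓH sₒ) with hB4
  set B5 := ΓH '' Icc sₒ 1 with hB5
  have hxs' := abs_lt.1 hxs
  have hys' := abs_lt.1 hys
  -- the four inner points are strictly inside the disc
  have hinner : ∀ {u v : ℝ}, u ^ 2 + v ^ 2 < r ^ 2 → ‖(⟨c₀.re + u, c₀.im + v⟩ : ℂ) - c₀‖ < r := by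
    intro u v huv
    rw [Complex.norm_def, Real.sqrt_lt' hr, Complex.normSq_apply]
    simp only [sub_re, sub_im]
    nlinarith
  have hsq1 : (xs - c₀.re) ^ 2 < (r / 5) ^ 2 := by rw [← sq_abs]; exact pow_lt_pow_left₀ hxs (abs_nonneg _) two_ne_zero
  have hsq2 : (ys - c₀.im) ^ 2 < (r / 5) ^ 2 := by rw [← sq_abs]; exact pow_lt_pow_left₀ hys (abs_nonneg _) two_ne_zero
  have hQvm_in : ‖Qvm - c₀‖ < r := by
    have := hinner (u := xs - c₀.re) (v := -(r / 2)) (by nlinarith)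
    convert this using 2; rw [hQvm]; apply Complex.ext <;> simp
  have hQvp_in : ‖Qvp - c₀‖ < r := by
    have := hinner (u := xs - c₀.re) (v := r / 2) (by nlinarith)
    convert this using 2; rw [hQvp]; apply Complex.ext <;> simp
  have hQhm_in : ‖Qhm - c₀‖ < r := by
    have := hinner (u := -(r / 2)) (v := ys - c₀.im) (by nlinarith)
    convert this using 2; rw [hQhm]; apply Complex.ext <;> simp
  have hQhp_in : ‖Qhp - c₀‖ < r := by
    have := hinner (u := r / 2) (v := ys - c₀.im) (by nlinarith)
    convert this using 2; rw [hQhp]; apply Complex.ext <;> simp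
  -- coordinates of the entrance points
  obtain ⟨-, -, -, hVi_im⟩ := re_im_bounds_of_norm_le hclVi
  obtain ⟨-, -, hVo_im, -⟩ := re_im_bounds_of_norm_le hclVo
  obtain ⟨-, hHi_re, hHi_im1, hHi_im2⟩ := re_im_bounds_of_norm_le hclHi
  obtain ⟨hHo_re, -, hHo_im1, hHo_im2⟩ := re_im_bounds_of_norm_le hclHo
  simp only [sub_im, mul_im, ofReal_re, I_im, ofReal_im, I_re, add_im, sub_re, add_re] at hVi_im hVo_im hHi_re hHi_im1 hHi_im2 hHo_re hHo_im1 hHo_im2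
  -- coordinate envelopes of the straight pieces
  have eQvm_re : Qvm.re = xs := rfl
  have eQvm_im : Qvm.im = c₀.im - r / 2 := rfl
  have eQvp_re : Qvp.re = xs := rfl
  have eQvp_im : Qvp.im = c₀.im + r / 2 := rfl
  have eQhm_re : Qhm.re = c₀.re - r / 2 := rfl
  have eQhm_im : Qhm.im = ys := rfl
  have eQhp_re : Qhp.re = c₀.re + r / 2 := rfl
  have eQhp_im : Qhp.im = ys := rfl
  have hA2_im : ∀ z ∈ A2, z.im ≤ c₀.im - r / 2 := fun z hz =>
    im_le_of_mem_segment hz (by linarith) (by rw [eQvm_im])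
  have hA4_im : ∀ z ∈ A4, c₀.im + r / 2 ≤ z.im := fun z hz =>
    le_im_of_mem_segment hz (by rw [eQvp_im]) (by linarith)
  have hA3_re : ∀ z ∈ A3, z.re = xs := fun z hz =>
    le_antisymm (re_le_of_mem_segment hz (by rw [eQvm_re]) (by rw [eQvp_re])) (le_re_of_mem_segment hz (by rw [eQvm_re]) (by rw [eQvp_re]))
  have hB2_re : ∀ z ∈ B2, z.re ≤ c₀.re - r / 2 := fun z hz =>
    re_le_of_mem_segment hz (by linarith) (by rw [eQhm_re])
  have hB4_re : ∀ z ∈ B4, c₀.re + r / 2 ≤ z.re := fun z hz =>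
    le_re_of_mem_segment hz (by rw [eQhp_re]) (by linarith)
  have hB_im : ∀ z ∈ B2 ∪ B3 ∪ B4, |z.im - c₀.im| ≤ r / 5 := by
    rintro z ((hz | hz) | hz) <;> rw [abs_le] <;> constructor
    · linarith [le_im_of_mem_segment hz (m := c₀.im - r / 5) (by linarith) (by rw [eQhm_im]; linarith)]
    · linarith [im_le_of_mem_segment hz (m := c₀.im + r / 5) (by linarith) (by rw [eQhm_im]; linarith)]
    · linarith [le_im_of_mem_segment hz (m := c₀.im - r / 5) (by rw [eQhm_im]; linarith) (by rw [eQhp_im]; linarith)]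
    · linarith [im_le_of_mem_segment hz (m := c₀.im + r / 5) (by rw [eQhm_im]; linarith) (by rw [eQhp_im]; linarith)]
    · linarith [le_im_of_mem_segment hz (m := c₀.im - r / 5) (by rw [eQhp_im]; linarith) (by linarith)]
    · linarith [im_le_of_mem_segment hz (m := c₀.im + r / 5) (by rw [eQhp_im]; linarith) (by linarith)]
  -- the straight pieces are in the closed disc; `A3`, `B3` in the open disc
  have hA2_ball : A2 ⊆ closedBall c₀ r := segment_subset_closedBall' hnVi.le hQvm_in.le
  have hA3_ball : ∀ z ∈ A3, ‖z - c₀‖ < r := fun z hz =>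
    mem_ball_iff_norm.1 ((convex_ball c₀ r).segment_subset (mem_ball_iff_norm.2 hQvm_in) (mem_ball_iff_norm.2 hQvp_in) hz)
  have hA4_ball : A4 ⊆ closedBall c₀ r := segment_subset_closedBall' hQvp_in.le hnVo.le
  have hB2_ball : B2 ⊆ closedBall c₀ r := segment_subset_closedBall' hnHi.le hQhm_in.le
  have hB3_ball : ∀ z ∈ B3, ‖z - c₀‖ < r := fun z hz =>
    mem_ball_iff_norm.1 ((convex_ball c₀ r).segment_subset (mem_ball_iff_norm.2 hQhm_in) (mem_ball_iff_norm.2 hQhp_in) hz)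
  have hB4_ball : B4 ⊆ closedBall c₀ r := segment_subset_closedBall' hQhp_in.le hnHo.le
  have hA234 : A2 ∪ A3 ∪ A4 ⊆ closedBall c₀ r := by
    rintro z ((hz | hz) | hz)
    · exact hA2_ball hz
    · exact mem_closedBall_iff_norm.2 (hA3_ball z hz).le
    · exact hA4_ball hz
  have hB234 : B2 ∪ B3 ∪ B4 ⊆ closedBall c₀ r := by
    rintro z ((hz | hz) | hz)
    · exact hB2_ball hz
    · exact mem_closedBall_iff_norm.2 (hB3_ball z hz).le
    · exact hB4_ball hz
  -- the sphere points of the pieces in the disc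
  have hA2_sph : ∀ z ∈ A2, ‖z - c₀‖ = r → z = ΓV tᵢ := fun z hz hzr => by
    by_contra hne; exact (norm_sub_lt_of_mem_segment hnVi.le hQvm_in hz hne).ne hzr
  have hA4_sph : ∀ z ∈ A4, ‖z - c₀‖ = r → z = ΓV tₒ := fun z hz hzr => by
    by_contra hne; rw [hA4, segment_symm] at hz; exact (norm_sub_lt_of_mem_segment hnVo.le hQvp_in hz hne).ne hzr
  have hB2_sph : ∀ z ∈ B2, ‖z - c₀‖ = r → z = ΓH sᵢ := fun z hz hzr => by
    by_contra hne; exact (norm_sub_lt_of_mem_segment hnHi.le hQhm_in hz hne).ne hzr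
  have hB4_sph : ∀ z ∈ B4, ‖z - c₀‖ = r → z = ΓH sₒ := fun z hz hzr => by
    by_contra hne; rw [hB4, segment_symm] at hz; exact (norm_sub_lt_of_mem_segment hnHo.le hQhp_in hz hne).ne hzr
  -- the curve pieces are outside the open disc, on the sphere only at the entrance points
  have hA1_out : ∀ z ∈ A1, r ≤ ‖z - c₀‖ ∧ (‖z - c₀‖ = r → z = ΓV tᵢ) := by
    rintro z ⟨t, ht, rfl⟩
    rcases ht.2.lt_or_eq with h | rfl
    · exact ⟨(houtV1 t ⟨ht.1, h⟩).le, fun h' => ((houtV1 t ⟨ht.1, h⟩).ne' h').elim⟩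
    · exact ⟨hnVi.ge, fun _ => rfl⟩
  have hA5_out : ∀ z ∈ A5, r ≤ ‖z - c₀‖ ∧ (‖z - c₀‖ = r → z = ΓV tₒ) := by
    rintro z ⟨t, ht, rfl⟩
    rcases ht.1.lt_or_eq with h | h
    · exact ⟨(houtV2 t ⟨h, ht.2⟩).le, fun h' => ((houtV2 t ⟨h, ht.2⟩).ne' h').elim⟩
    · rw [← h]; exact ⟨hnVo.ge, fun _ => rfl⟩
  have hB1_out : ∀ z ∈ B1, r ≤ ‖z - c₀‖ ∧ (‖z - c₀‖ = r → z = ΓH sᵢ) := by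
    rintro z ⟨t, ht, rfl⟩
    rcases ht.2.lt_or_eq with h | rfl
    · exact ⟨(houtH1 t ⟨ht.1, h⟩).le, fun h' => ((houtH1 t ⟨ht.1, h⟩).ne' h').elim⟩
    · exact ⟨hnHi.ge, fun _ => rfl⟩
  have hB5_out : ∀ z ∈ B5, r ≤ ‖z - c₀‖ ∧ (‖z - c₀‖ = r → z = ΓH sₒ) := by
    rintro z ⟨t, ht, rfl⟩
    rcases ht.1.lt_or_eq with h | h
    · exact ⟨(houtH2 t ⟨h, ht.2⟩).le, fun h' => ((houtH2 t ⟨h, ht.2⟩).ne' h').elim⟩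
    · rw [← h]; exact ⟨hnHo.ge, fun _ => rfl⟩
  -- the entrance points are pairwise distinct across the two curves
  have hne : ∀ {t s : ℝ}, t ∈ Icc (0 : ℝ) 1 → s ∈ Icc (0 : ℝ) 1 → t ≠ 1 / 2 → ΓV t ≠ ΓH s :=
    fun ht hs hth h => hth (hmeet _ ht _ hs h).1
  have htᵢI : tᵢ ∈ Icc (0 : ℝ) 1 := ⟨htᵢ.le, by linarith⟩
  have htₒI : tₒ ∈ Icc (0 : ℝ) 1 := ⟨by linarith, htₒ.le⟩
  have hsᵢI : sᵢ ∈ Icc (0 : ℝ) 1 := ⟨hsᵢ.le, by linarith⟩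
  have hsₒI : sₒ ∈ Icc (0 : ℝ) 1 := ⟨by linarith, hsₒ.le⟩
  -- generic: an "outside" piece vs an "inside" piece meet only at a common sphere point
  have key : ∀ {X Y : Set ℂ} {x₀ y₀ : ℂ}, (∀ z ∈ X, r ≤ ‖z - c₀‖ ∧ (‖z - c₀‖ = r → z = x₀)) →
      Y ⊆ closedBall c₀ r → (∀ z ∈ Y, ‖z - c₀‖ = r → z = y₀) → x₀ ≠ y₀ → Disjoint X Y := by
    intro X Y x₀ y₀ hX hY hYs hxy
    rw [Set.disjoint_left]
    intro z hzX hzY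
    have h1 := hX z hzX
    have h2 : ‖z - c₀‖ ≤ r := mem_closedBall_iff_norm.1 (hY hzY)
    have h3 : ‖z - c₀‖ = r := le_antisymm h2 h1.1
    exact hxy ((h1.2 h3).symm.trans (hYs z hzY h3))
  -- curve vs curve
  have kcc : ∀ {P : ℝ → Prop} {Q : ℝ → Prop} , (∀ t, P t → t ∈ Icc (0 : ℝ) 1 ∧ t ≠ 1 / 2) → (∀ s, Q s → s ∈ Icc (0 : ℝ) 1) →
      Disjoint (ΓV '' {t | P t}) (ΓH '' {s | Q s}) := by
    intro P Q hP hQ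
    rw [Set.disjoint_left]
    rintro z ⟨t, ht, rfl⟩ ⟨s, hs, hs'⟩
    exact hne (hP t ht).1 (hQ s hs) (hP t ht).2 hs'.symm
  have hA1B1 : Disjoint A1 B1 := kcc (P := fun t => t ∈ Icc 0 tᵢ) (Q := fun s => s ∈ Icc 0 sᵢ)
    (fun t ht => ⟨⟨ht.1, by linarith [ht.2]⟩, by linarith [ht.2]⟩) (fun s hs => ⟨hs.1, by linarith [hs.2]⟩)
  have hA1B5 : Disjoint A1 B5 := kcc (P := fun t => t ∈ Icc 0 tᵢ) (Q := fun s => s ∈ Icc sₒ 1)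
    (fun t ht => ⟨⟨ht.1, by linarith [ht.2]⟩, by linarith [ht.2]⟩) (fun s hs => ⟨by linarith [hs.1], hs.2⟩)
  have hA5B1 : Disjoint A5 B1 := kcc (P := fun t => t ∈ Icc tₒ 1) (Q := fun s => s ∈ Icc 0 sᵢ)
    (fun t ht => ⟨⟨by linarith [ht.1], ht.2⟩, by linarith [ht.1]⟩) (fun s hs => ⟨hs.1, by linarith [hs.2]⟩)
  have hA5B5 : Disjoint A5 B5 := kcc (P := fun t => t ∈ Icc tₒ 1) (Q := fun s => s ∈ Icc sₒ 1)
    (fun t ht => ⟨⟨by linarith [ht.1], ht.2⟩, by linarith [ht.1]⟩) (fun s hs => ⟨by linarith [hs.1], hs.2⟩)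
  -- outside pieces vs inside pieces
  have hViHi : ΓV tᵢ ≠ ΓH sᵢ := hne htᵢI hsᵢI (by linarith)
  have hViHo : ΓV tᵢ ≠ ΓH sₒ := hne htᵢI hsₒI (by linarith)
  have hVoHi : ΓV tₒ ≠ ΓH sᵢ := hne htₒI hsᵢI (by linarith)
  have hVoHo : ΓV tₒ ≠ ΓH sₒ := hne htₒI hsₒI (by linarith)
  have hA1B2 : Disjoint A1 B2 := key hA1_out hB2_ball hB2_sph hViHi
  have hA1B4 : Disjoint A1 B4 := key hA1_out hB4_ball hB4_sph hViHo
  have hA5B2 : Disjoint A5 B2 := key hA5_out hB2_ball hB2_sph hVoHi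
  have hA5B4 : Disjoint A5 B4 := key hA5_out hB4_ball hB4_sph hVoHo
  have hB1A2 : Disjoint B1 A2 := key hB1_out hA2_ball hA2_sph hViHi.symm
  have hB1A4 : Disjoint B1 A4 := key hB1_out hA4_ball hA4_sph hVoHi.symm
  have hB5A2 : Disjoint B5 A2 := key hB5_out hA2_ball hA2_sph hViHo.symm
  have hB5A4 : Disjoint B5 A4 := key hB5_out hA4_ball hA4_sph hVoHo.symm
  -- outside pieces vs the open-disc pieces `A3`, `B3`
  have kopen : ∀ {X Y : Set ℂ}, (∀ z ∈ X, r ≤ ‖z - c₀‖) → (∀ z ∈ Y, ‖z - c₀‖ < r) → Disjoint X Y := by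
    intro X Y hX hY
    rw [Set.disjoint_left]
    intro z hzX hzY
    exact (lt_irrefl _ ((hY z hzY).trans_le (hX z hzX)))
  have hA1B3 : Disjoint A1 B3 := kopen (fun z hz => (hA1_out z hz).1) hB3_ball
  have hA5B3 : Disjoint A5 B3 := kopen (fun z hz => (hA5_out z hz).1) hB3_ball
  have hB1A3 : Disjoint B1 A3 := kopen (fun z hz => (hB1_out z hz).1) hA3_ball
  have hB5A3 : Disjoint B5 A3 := kopen (fun z hz => (hB5_out z hz).1) hA3_ball
  -- straight pieces by coordinates
  have kim : ∀ {X Y : Set ℂ}, (∀ z ∈ X, z.im ≤ c₀.im - r / 2) → (∀ z ∈ Y, |z.im - c₀.im| ≤ r / 5) → Disjoint X Y := by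
    intro X Y hX hY
    rw [Set.disjoint_left]
    intro z hzX hzY
    have := abs_le.1 (hY z hzY); linarith [hX z hzX]
  have kim' : ∀ {X Y : Set ℂ}, (∀ z ∈ X, c₀.im + r / 2 ≤ z.im) → (∀ z ∈ Y, |z.im - c₀.im| ≤ r / 5) → Disjoint X Y := by
    intro X Y hX hY
    rw [Set.disjoint_left]
    intro z hzX hzY
    have := abs_le.1 (hY z hzY); linarith [hX z hzX]
  have hB234im : ∀ z ∈ B2, |z.im - c₀.im| ≤ r / 5 := fun z hz => hB_im z (Or.inl (Or.inl hz))
  have hB3im : ∀ z ∈ B3, |z.im - c₀.im| ≤ r / 5 := fun z hz => hB_im z (Or.inl (Or.inr hz))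
  have hB4im : ∀ z ∈ B4, |z.im - c₀.im| ≤ r / 5 := fun z hz => hB_im z (Or.inr hz)
  have hA2B2 : Disjoint A2 B2 := kim hA2_im hB234im
  have hA2B3 : Disjoint A2 B3 := kim hA2_im hB3im
  have hA2B4 : Disjoint A2 B4 := kim hA2_im hB4im
  have hA4B2 : Disjoint A4 B2 := kim' hA4_im hB234im
  have hA4B3 : Disjoint A4 B3 := kim' hA4_im hB3im
  have hA4B4 : Disjoint A4 B4 := kim' hA4_im hB4im
  have hB2A3 : Disjoint B2 A3 := by
    rw [Set.disjoint_left]; intro z hzB hzA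
    have h1 := hB2_re z hzB; have h2 := hA3_re z hzA; linarith
  have hB4A3 : Disjoint B4 A3 := by
    rw [Set.disjoint_left]; intro z hzB hzA
    have h1 := hB4_re z hzB; have h2 := hA3_re z hzA; linarith
  -- assembly
  have D : ∀ {X Y : Set ℂ} {z : ℂ}, Disjoint X Y → z ∈ X → z ∈ Y → False := fun h hx hy => Set.disjoint_left.1 h hx hy
  refine ⟨?_, ?_, hA234, hB234⟩
  · rw [Set.disjoint_left]
    rintro z (((h1 | h2) | h4) | h5) ((((g1 | g2) | g3) | g4) | g5)
    · exact D hA1B1 h1 g1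
    · exact D hA1B2 h1 g2
    · exact D hA1B3 h1 g3
    · exact D hA1B4 h1 g4
    · exact D hA1B5 h1 g5
    · exact D hB1A2 g1 h2
    · exact D hA2B2 h2 g2
    · exact D hA2B3 h2 g3
    · exact D hA2B4 h2 g4
    · exact D hB5A2 g5 h2
    · exact D hB1A4 g1 h4
    · exact D hA4B2 h4 g2
    · exact D hA4B3 h4 g3
    · exact D hA4B4 h4 g4
    · exact D hB5A4 g5 h4
    · exact D hA5B1 h5 g1
    · exact D hA5B2 h5 g2
    · exact D hA5B3 h5 g3
    · exact D hA5B4 h5 g4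
    · exact D hA5B5 h5 g5
  · rw [Set.disjoint_left]
    rintro z (((g1 | g2) | g4) | g5) ((((h1 | h2) | h3) | h4) | h5)
    · exact D hA1B1 h1 g1
    · exact D hB1A2 g1 h2
    · exact D hB1A3 g1 h3
    · exact D hB1A4 g1 h4
    · exact D hA5B1 h5 g1
    · exact D hA1B2 h1 g2
    · exact D hA2B2 h2 g2
    · exact D hB2A3 g2 h3
    · exact D hA4B2 h4 g2
    · exact D hA5B2 h5 g2
    · exact D hA1B4 h1 g4
    · exact D hA2B4 h2 g4
    · exact D hB4A3 g4 h3
    · exact D hA4B4 h4 g4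
    · exact D hA5B4 h5 g4
    · exact D hA1B5 h1 g5
    · exact D hB5A2 g5 h2
    · exact D hB5A3 g5 h3
    · exact D hB5A4 g5 h4
    · exact D hA5B5 h5 g5

end CrossSeparation

/-! ### §X7. Exterior closing curves from the Schoenflies homeomorphism -/

section Exterior

open Literature.Probability.RandomPlanarGeometry

/-- **Exterior closing curves.** For two boundary points `q_t, q_b` of a Jordan domain there are
curves `E_t, E_b : [1, 2] → ℂ` starting at them and otherwise in the exterior `ℂ ∖ closure D`,
and a curve `M : [0, 1] → ℂ` in the exterior joining their far ends — the images of two radii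
and an arc of the circle of radius `2` under the homeomorphism of `ℂ` extending a Carathéodory
chart (`JordanDomain.DiscChart.exists_homeomorph_eqOn`). [folklore] -/
theorem exists_exterior_curves (D : JordanDomain) {qt qb : ℂ} (hqt : qt ∈ frontier D.carrier)
    (hqb : qb ∈ frontier D.carrier) :
    ∃ Et Eb M : ℝ → ℂ, ContinuousOn Et (Icc 1 2) ∧ ContinuousOn Eb (Icc 1 2) ∧ ContinuousOn M (Icc 0 1) ∧
      Et 1 = qt ∧ Eb 1 = qb ∧ (∀ t ∈ Ioc (1 : ℝ) 2, Et t ∈ (closure D.carrier)ᶜ) ∧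
      (∀ t ∈ Ioc (1 : ℝ) 2, Eb t ∈ (closure D.carrier)ᶜ) ∧ (∀ s ∈ Icc (0 : ℝ) 1, M s ∈ (closure D.carrier)ᶜ) ∧
      M 0 = Et 2 ∧ M 1 = Eb 2 := by
  obtain ⟨z₀, hz₀⟩ := D.nonempty
  obtain ⟨C, -⟩ := D.exists_discChart_apply_eq hz₀
  obtain ⟨H, -, -, hsph, -, hext⟩ := C.exists_homeomorph_eqOn
  -- preimages on the circle
  have hpre : ∀ {q : ℂ}, q ∈ frontier D.carrier → ∃ ζ : ℂ, ‖ζ‖ = 1 ∧ H ζ = q := by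
    intro q hq
    rw [← hsph] at hq
    obtain ⟨ζ, hζ, rfl⟩ := hq
    exact ⟨ζ, mem_sphere_zero_iff_norm.1 hζ, rfl⟩
  obtain ⟨ζt, hζt, hHt⟩ := hpre hqt
  obtain ⟨ζb, hζb, hHb⟩ := hpre hqb
  have hexterior : ∀ w : ℂ, 1 < ‖w‖ → H w ∈ (closure D.carrier)ᶜ := by
    intro w hw
    rw [← hext]
    exact mem_image_of_mem H (by rw [mem_compl_iff, mem_closedBall_zero_iff]; exact not_le.2 hw)
  set θt : ℝ := Complex.arg ζt with hθt
  set θb : ℝ := Complex.arg ζb with hθb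
  have hζt' : Complex.exp (θt * I) = ζt := by
    have := Complex.norm_mul_exp_arg_mul_I ζt; rwa [hζt, Complex.ofReal_one, one_mul] at this
  have hζb' : Complex.exp (θb * I) = ζb := by
    have := Complex.norm_mul_exp_arg_mul_I ζb; rwa [hζb, Complex.ofReal_one, one_mul] at this
  refine ⟨fun t => H ((t : ℂ) * ζt), fun t => H ((t : ℂ) * ζb),
    fun s => H (2 * Complex.exp (((θt + s * (θb - θt) : ℝ) : ℂ) * I)), ?_, ?_, ?_, ?_, ?_, ?_, ?_, ?_, ?_, ?_⟩
  · exact (H.continuous.comp (Complex.continuous_ofReal.mul continuous_const)).continuousOn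
  · exact (H.continuous.comp (Complex.continuous_ofReal.mul continuous_const)).continuousOn
  · refine (H.continuous.comp (continuous_const.mul (Complex.continuous_exp.comp ?_))).continuousOn
    exact (Complex.continuous_ofReal.comp (continuous_const.add (continuous_id.mul continuous_const))).mul continuous_const
  · simp [hHt]
  · simp [hHb]
  · intro t ht
    apply hexterior
    rw [norm_mul, Complex.norm_real, Real.norm_of_nonneg (by linarith [ht.1]), hζt, mul_one]; exact ht.1
  · intro t ht
    apply hexterior
    rw [norm_mul, Complex.norm_real, Real.norm_of_nonneg (by linarith [ht.1]), hζb, mul_one]; exact ht.1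
  · intro s _
    apply hexterior
    rw [norm_mul, Complex.norm_exp_ofReal_mul_I, mul_one]; norm_num
  · show H (2 * Complex.exp (((θt + 0 * (θb - θt) : ℝ) : ℂ) * I)) = H (((2 : ℝ) : ℂ) * ζt)
    rw [zero_mul, add_zero, hζt']; norm_num
  · show H (2 * Complex.exp (((θt + 1 * (θb - θt) : ℝ) : ℂ) * I)) = H (((2 : ℝ) : ℂ) * ζb)
    rw [one_mul, add_sub_cancel, hζb']; norm_num

end Exterior

end SquareTiling

end Literature.Probability.LatticeModels
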